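/-
Copyright: cell `langlands-arthur-audit` (papers/Langlands/langlands-arthur-audit), unit `pub-arthur-down-g33`
(downstream tracer, gen 33).  Twenty-second file of the downstream register (module M195 of the cell's MODULE-MAP, CLAIMed in `lean/MODULE-MAP2.md`
2026-08-21T23:5xZ): `Downstream.lean` (tranches 1–4) … `Downstream20.lean` (74–77) are full or kept for small appends and `Downstream21.lean` (tranches
78–80, 60 % of the gate's 200 000-byte file cap after v3) is kept OPEN for small appends and errata — tranche 81 as an append would have taken it to ≈ 84 %
in one step — so the register continues here, APPEND-ONLY in the same conventions and the same namespace `…Arthur2013.Downstream`; this file imports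
`…Downstream21` (v3 in the tree; through it the whole register).  v1 = the eighty-first tranche (`Consumers81`: THE FORMAL DEGREE LINE — NEW census row
B119 A. Ichino – E. Lapid – Z. Mao, *On the formal degrees of square-integrable representations of odd special orthogonal and metaplectic groups*, Duke Math.
J. 166 (2017) 1301–1348 = arXiv:1404.2909 (ABSENT from the census; only its globalisation lemma was ever named, as an Arthur-free input of row C60):
`ILMllcSO` = the hypothesis « the local Langlands correspondence for SO(2n+1) » as their §5 spells it, with a SUPPLIER edge ⇐ the book typed from the
authors' own attribution (« which was established by Arthur [MR3135650] conditionally on the stabilization of the twisted trace formula »); `ILMgeneric` =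
their Theorems 2.1 / 3.3 / 4.7 (the formal degree of square-integrable GL_n, of ψ-generic square-integrable Mp_n, of generic square-integrable split SO(2n+1)),
premise-free (descent, the Lapid – Mao Main Identity, Gan – Ichino 2014, Gan – Savin: Arthur-free); `ILMcor51` = their Corollary 5.1 (the formal degree conj. —
title word abbreviated throughout — for every square-integrable σ of split SO(2n+1)) ⇐ hypothesis ∧ generic; `ILMnonsplit` = the §5 closing reduction for
the non-split SO(2n+1)^- (« would follow from results announced by Arthur ») ⇐ the node `Consumers57.LLCoddSO` (tranche 57, reused) ∧ Cor. 5.1; NEW census row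
B120 Anantha Krishna B, arXiv:2605.26031 (2026, PREPRINT; cites neither the book nor Mok nor KMSW): HYPOTHESIS node `GVffLLC` = row B96 Ganapathy – Varma's
compatibility of the LLC for split Sp_2n / SO_2n / SO_2n+1 with the Deligne – Kazhdan correspondence as the paper states it (B96 unread by the cell, acq-08153:
no supplier edge), and `AKBformalDegreeFF` = its Theorem 9.1 (the formal degree conj. over local function fields for split GL_n, GSp_4, Sp_2n, SO_2n, SO_2n+1) ⇐
`ILMcor51` ∧ row B61's `Consumers24.BPformalDegree` ∧ node; `Implications81`; bookkeeping theorems); v1.1 (same unit) = a DOCSTRING / COMMENT-ONLY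
erratum over v1 = p310431 (v1 as filed was the generator's first output: the module-docstring sentence on the B119 forward-citation sweep is replaced by the
completed sweep's — 12 census rows, 13 uncensused texts grepped, the three papers that use or discuss B119 named — with the Henniart – Oi status-witness
comment line, and the corpus locator of Corollary 5.1 is corrected to `paper-arxiv-1404.2909` p0016:L53 / L53-62; every declaration and statement byte-
identical); v2 (same unit) = the eighty-second tranche (`Consumers82`: MR-NUMBER CITERS OF THE BOOK, II — four
arithmetic consumers ABSENT from the census, surfaced by the full-text search of the held corpus for the book's MR number 3135650 and its bibliography
line, diffed against `DOWNSTREAM*.md` (147 held documents cite the book that way; 31 have no census row; 12 of those are bundled-`.bib` false positives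
with no citation in the body): NEW row C206 D. Barrera Salazar – A. Graham – C. Williams, arXiv:2508.10225 (2025, PREPRINT): `BGWchar0` (their Theorem
(Thm:PiCARoftildeGLG) of §9 — Galois representations with local-global compatibility at p for ordinary regular algebraic cuspidal Π of GSp_2n(𝔸_ℚ) —
« By the work of Arthur » ⇐ book), `BGWthmD` (Theorem D, local-global compatibility at ℓ = p for ordinary torsion eigensystems of GL_n/ℚ ⇐ BGWchar0
∧ book, Scholze's torsion classes entering as the authors attribute them, « relies on Arthur's endscopic classification for symplectic groups »),
`BGWthmB` (Theorem B, « completely unconditional », premise-free), `BGWezc` (Theorems A and C — the exceptional zero conj. for GL(3) — ⇐ Theorem D);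
their Remark after Theorem D is the most accurate 2025 status sentence in the register (« the only thing that remains is the proof of the twisted
weighted fundamental lemma »); NEW row C207 X. Zhang, arXiv:2411.04897v2 (2024/2025, PREPRINT): `XZgalois` (Theorems 2.3 / 2.6: weak transfer and
ᶜG-valued Galois representations for discrete automorphic π of a definite special orthogonal / symplectic G over totally real F ⇐ row E1's `Shin.WeakS`
∧ `Shin.GalRepGLN`, with the author's sentence that Shin's hypothesis (H1) — the two unwritten weighted fundamental lemmas — « is already proved in
[Arthur2001, Arthur2002, Arthur2003] »), `XZRT` (Theorems 1.1 / 6.4 / 6.5, minimal R = 𝕋 ⇐ XZgalois), `XZBK` (Theorems 7.5 / 7.6, the Bloch – Kato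
statements for Ad ρ_π ⇐ XZRT ∧ row A3's `Consumers.TaibiInner` ∧ book); NEW row C208 G. Boxer – V. Pilloni, *Higher Coleman Theory*,
arXiv:2110.10251 (2021, PREPRINT): `BPweakRegLGC` (the Theorem of their §1.4 = §6.11: Galois representations with local-global compatibility at p for
weakly regular odd essentially conjugate self-dual cuspidal π of GL_n over CM / totally real L ⇐ Mok ∧ row C141's `Consumers74.FPWeaklyRegular`; « therefore
conditional on the results announced in [MR3135650] »); NEW row C209 J. Enns – H. Lee, Doc. Math. 29 (2024) 863–919 (PUBLISHED): `ELstableTempered`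
(Corollary 4.1.1 and Lemma 4.1.7: multiplicity one and « stable and tempered » for the relevant automorphic representations of GSp_4 and its inner
form, « by using various results on Arthur multiplicity formula [2, 28, 54] » ⇐ book ∧ row A4's `Consumers.GeeTaibi` ∧ row A3's `Consumers.TaibiInner`),
`ELmain` (Theorem 4.5.1, mod p local-global compatibility for GSp_4(ℚ_p) in the ordinary case ⇐ ELstableTempered); `Implications82`; bookkeeping
theorems).  Nothing of the first twenty-one files is redeclared or changed.
-/
import HarnessLib
import Literature.NumberTheory.Automorphic.Arthur2013.Downstream21

/-!
# Downstream of Arthur (2013), Mok (2015), KMSW (2014): the typed register, twenty-second file (tranches ≥ 81)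

**What is reproduced.**  As in the first twenty-one files: for published theorems that invoke J. Arthur, *The Endoscopic
Classification of Representations* (AMS Colloq. Publ. 61, 2013) [cite: Arthur2013], C. P. Mok's memoir [cite: Mok2012] or
Kaletha – Mínguez – Shin – White [claim: KalethaMinguezShinWhite2014, under-review], one HYPOTHESIS `E_…` per statement
quoting the sentences in which the paper invokes them (or invokes an already-typed consumer), recording WHICH leaves and
nodes of the three dependency DAGs the proof consumes; and bookkeeping theorems composing these hypotheses with the packaged
inputs `BookInputs`, `MokInputs`, `KMSWInputs` of `Downstream.lean`.  Quotations are exact substrings of the cell's texts, staged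
byte-identically with sha256 under `HOME/pub-arthur-down-g33/primaries/` (`SHA256SUMS`): the arXiv E-PRINT SOURCES (fetched read-only from arxiv.org/src/<id> on
2026-08-21; `eprint/headers-<id>.txt` keep the `content-disposition` lines) `src-1404.2909v2/formalsubmission240714.tex` (row B119; `eprint/1404.2909.eprint` =
arXiv-1404.2909v2.gz, last-modified 2021-08-10, sha256 a61372bc…; tex 5854172e…, 2212 lines; theorem numbers from the source's `\newtheorem` counters — Theorem
2.1 = thm: GLn l.338, Theorem 3.1 = thm: bijection l.539, Theorem 3.2 = thm: main l.553, Theorem 3.3 = thm: Mpn l.572, Theorem 4.7 = thm: so l.1155, Corollary 5.1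
= cor: nongen l.1225 — agreeing with the corpus rendering `paper-arxiv-1404.2909` p0016:L53 « Corollary 5.1. » and with row B120's citation « [ILM17, Corollary
5.1] ») and `src-2605.26031v1/formaldegree.tex` (row B120; `eprint/2605.26031.eprint` = arXiv-2605.26031v1.tar.gz of 2026-05-26, sha256 b7b2a0fb…; tex 96e5333c…,
1425 lines; Theorem 1.1 l.262, Theorem 5.1 l.789, Theorem 8.1 l.1140, Theorem 9.1 l.1224, matching the numbers printed in the arXiv PDF text `paper-arxiv-2605.26031`),
the zbMATH review Zbl 1398.11079 of row B96 (`zbmath-1398.11079/review.txt`, fetched read-only from api.zbmath.org on 2026-08-21), and the corpus TeX / PDF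
texts `paper-arxiv-1404.2909` (26 chunks), `paper-arxiv-1401.0198` (30), `paper-arxiv-1404.2905` (24), `paper-arxiv-1412.4886` (21), `paper-arxiv-2012.04219` (52),
`paper-arxiv-2605.26031` (22 pages) for the examined rows — locators `l.N` (source line) and `pNNNN:Ln`.  Sentences that name a conj. (both abstracts, the
« formal degree conj. » sentences, theorem headings, titles) or are bibliography entries are Lean `--` comments, cited by locator; in docstrings the title word is
abbreviated « conj. » and such sentences are paraphrased in square brackets.  The census rows under test: none — `DOWNSTREAM.md` / `DOWNSTREAM2.md` /
`DOWNSTREAM3.md` have no row for either paper (B119's only trace: « Ichino – Lapid – Mao [ILM] (globalisation) » among the Arthur-free inputs absorbed in row C60's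
edge, tranche 34; §I.2 lists K. Morimoto, Trans. AMS 2018, a direct citer, as metadata-only); block `[g33]` of `DOWNSTREAM3.md` (this tranche: B119, B120 NEW;
controls E56–E58 NEW, census only).  v2 adds, staged the same way (`primaries/SHA256SUMS`): the e-print sources `src-2508.10225v2/ezc.tex` (row C206;
`eprint/2508.10225.eprint` = arXiv-2508.10225v2.tar.gz, last-modified 2025-10-01, sha256 5c95793d…; the four introduction theorems are `theoremx` on the
counter `alphalabels` = Theorems A–D in source order l.264 / l.340 / l.388 / l.432; body statements are cited by label and line, §9 = `LGcompatAtl=pSec`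
l.3070), `src-2411.04897v2/Automorphic_side_of_Taylor-Wiles_method_for_orthogonal_and_symplectic_groups.tex` (row C207; arXiv-2411.04897v2.tar.gz,
last-modified 2025-08-21, sha256 8da9e71d…; `\newtheorem{theorem}{Theorem}[section]` with one shared counter: Theorem 1.1 = `Theorem-1 R=T` l.371,
1.5 = `Theorem 3 Bloch-Kato` l.466, 2.3 = `weak transfer pi to Pi` l.986, 2.6 = `Galois representations attached to auto rep` l.1082, 6.4 = `R=T` l.10366,
6.5 = `modularity` l.10596, 7.5 / 7.6 = `Bloch-Kato, rank part` / `special value part` l.11012 / l.11036, computed by `work/texnum.py`; the corpus text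
`paper-arxiv-2411.04897` is v1 and differs — quoted once, as v1), `src-2110.10251v1/HigherColemanarxiv.tex` + `.bbl` (row C208; arXiv-2110.10251v1.tar.gz,
sha256 6428c6bc…; theorem-like environments share the `subsubsection` counter, so the two statements are cited by section and line: §1.4 l.341,
§6.11 l.5433), and the publisher PDF text `paper-doi-10-4171-dm-960` (row C209, 58 pp., numbered references [n]); for the examined non-rows the corpus
texts `paper-arxiv-2508.09066`, `-1208.2257`, `-2412.09738`, `-1509.01863`, `-2406.03617`, `paper-doi-10-2140-pjm-2016-281-2`.  Block `[g33b]` of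
`DOWNSTREAM3.md` (rows C206–C209 NEW; control E59 NEW, census only).

**Why an eighty-first tranche: the formal degree line (Ichino – Lapid – Mao 2017) and its first positive-characteristic consumer.**  ROW B119 (NEW census row): A. Ichino – E. Lapid –
Z. Mao, *On the formal degrees of square-integrable representations of odd special orthogonal and metaplectic groups*, Duke Math. J. 166 (2017) no. 7, 1301–1348,
doi:10.1215/00127094-0000001X — absent from `DOWNSTREAM.md` / `DOWNSTREAM2.md` / `DOWNSTREAM3.md` and from the register (it cites the book by MR number, invisible to the
DOI-linked forward-citation censuses; the only earlier mention is « Ichino – Lapid – Mao [ILM] (globalisation) » among the Arthur-free inputs absorbed in row C60's edge,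
tranche 34).  Its unconditional theorems are Arthur-free: l.160 "The work of Jiang--Soudry \cite{MR1983781, MR2058617}, which is based on the descent method of Ginzburg--Rallis--Soudry \cite{MR1671452, MR1954940, MR2848523}," […] l.172 "The proof is based on the Main Identity of the second and third named authors \cite{1404.2905}." […] l.177 "Using the above result for $\Mp_n$ and the result of \cite{MR3166215} we conclude that for any $\sigma\in\Irr_{\sqr,\gen}\SO(2n+1)$" [(eq: so2n+1)] […] l.183 "the theta correspondence due to Gan--Savin \cite{MR2999299}." l.552 "We now quote a corollary of the main result of \cite{1404.2905}." l.553 "\begin{theorem}[{\cite[Corollary 3.4]{1404.2905}}] \label{thm: main}"  Its general case is not: l.185 "Under the local Langlands correspondence for $\SO(2n+1)$, which would follow from Arthur's work \cite{MR3135650} once its" l.186 "prerequisites are established," [we get the formal degree conj. for SO(2n+1) (as well as for Mp_n) in full generality in §5.] l.188 "Indeed, given a square-integrable $L$-packet $\mathfrak{P}$, the relation \eqref{eq: so2n+1} is the required relation" l.189 "for the generic member of $\mathfrak{P}$ and as explained in \cite[\S9]{MR1070599}, the endoscopic character relations show that" l.190 "the formal degree is constant on $\mathfrak{P}$." l.191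 "Similarly, a similar statement for non-split $\SO(2n+1)$ would follow from results announced by Arthur."  §5: [§5 opens: « We now prove the formal degree conj. for SO(2n+1), under the assumption of the local Langlands correspondence, »] l.1186 "which was established by Arthur \cite{MR3135650} conditionally on the stabilization of the twisted trace formula." (the
hypothesis as spelled out, Corollary 5.1, its proof and the non-split reduction are quoted in the fields and edges below).  THE TYPING.  (1) `ILMllcSO` = the hypothesis of Corollary 5.1 as §5 spells it (partition of Irr_sqr SO(2n+1) into packets Π_φ over square-integrable φ : WD_F → Sp_n(ℂ),
the bijection with the characters of 𝒮_φ, stability and the endoscopic character relations (eq: transfer), and the two facts the proof takes from [MR3135650]: its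
Proposition 8.3.2 — the member with trivial character is generic — and the globalisation « as explained in the proof of [loc. cit.] »), with a SUPPLIER edge
`E_ILMllcSO : (∀ N, ν.Everything N) → _` typed from the authors' two attribution sentences ([MR3135650] = the book) — the pattern of row B7's `LLCdes` (tranche 5).
(2) `ILMgeneric` = Theorems 2.1, 3.3, 4.7 (with Theorem 3.1, the descent bijection), premise-free `E_ILMgeneric : _` (Jiang – Soudry, Ginzburg – Rallis – Soudry, the
Main Identity [1404.2905, Cor. 3.4] = Lapid – Mao, Algebra Number Theory 11 (2017), Gan – Ichino [MR3166215] = Invent. Math. 195 (2014) = row E47 (control), Gan – Savin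
[MR2999299] = row B112's Arthur-free theorems, Henniart, Silberger – Zink, Harish-Chandra: all Arthur-free; the paper's own footnote to §4: [the Jiang – Soudry results are
proved independently of the LLC]).  (3) `ILMcor51` = Corollary 5.1's conclusion ⇐ `ILMllcSO` ∧ `ILMgeneric` (the corollary as printed carries « If we admit the local
Langlands correspondence for SO(2n+1) » as its hypothesis).  (4) `ILMnonsplit` = the conclusion of the §5 closing reduction (the formal degree conj. for the square-
integrable representations of SO(2n+1)^-) ⇐ `Consumers57.LLCoddSO` (tranche 57's node « the local Langlands correspondence for SO(V^±) » — exactly the joint Vogan-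
packet statement the authors « admit (cf. [WaldAst3472, §4.2]) »; its two supply edges of tranche 57 run through rows A8-p and A5) ∧ `ILMcor51` (« reduce … to that for
SO(2n+1)^+ »).  ROW B120 (NEW census row, found by the forward-citation sweep of B119 in the LOCAL graph — 41 entries = 34 works,
`work/sweep_ILM_citers.txt`: 12 are census rows or typed controls (B61, B30, B9, C1, C25, C60, E5 …); the 13 uncensused held texts were grepped for
classification needles and for any USE of B119: the only use of Corollary 5.1 is this paper's; E. Kaplan, Israel J. Math. 2017 = arXiv:1502.06643 uses B119's
Arthur-free appendix (p0018:L66 "Now according to Ichino, Lapid and Mao [ILM] (Corollary A.6," […]); Dong – Gao – Wang arXiv:2304.06595 compare (p0016:L2-3 "The above theorem is clearly compatible with the work of Ichino–Lapid –Mao [ILM17], Gan–Ichino [GI14] and Gan–Savin [ GS12a, GS12b] on the formal degrees of discrete series" [… of Mp_2r …]); G. Henniart – M. Oi arXiv:2307.15248 (Swan exponents; theorems Arthur-free) cite the book for the correspondence, p0019:L19-20 "groups, the correspondence has been established; for example, quasi-split symplectic and orthogonal groups by Arthur [Art13]. Our motivation is to seek an explicit", and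
write, as MOTIVATION only, that the formal degree conj. « in this case has been already solved ([ILM17] for SO_2n+1 and [BP21] for SO_2n and Sp_2n) » (p0020:L45-46,
verbatim in the `--` comment below) — a status witness, not a row; the rest bibliographic): Anantha Krishna B (Indian Institute of Science; l.1235 "The author would like to thank his supervisor, Radhika Ganapathy, for suggesting this problem and for her constant guidance."), *The formal degree conj. for groups over local function fields* (title word abbreviated), arXiv:2605.26031v1 (2026-05-25,
PREPRINT).  Theorem 1.1: l.262 "\begin{theorem}[Loose version]" [Let F be a local field with char(F) = p > 0. Then the formal degree conj. holds for discrete series representations of following split groups defined over F:] l.264 "        \item $\GL_n,$" l.265 "        \item $\GSp_4 (p > 2),$" l.266 "        \item $\Sp_{2n}, \SO_{2n},$ and $\SO_{2n+1} (p >2).$" l.270 "For an exact version of the above theorem, see Theorem \ref{thm:Formal_deg_over_function_field}. To prove this, we first prove that the formal degrees of discrete series representations are equal under Kazhdan's isomorphism whenever the fields are sufficiently close (Theorem \ref{formal_degrees_are_equal1}). We also match the component groups and adjoint gamma factors over close local fields using Deligne's isomorphism (Section \ref{sec:Parameters_over_close_fields})."  §8 runs under a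
standing compatibility hypothesis (quoted in the node's docstring below) — Theorem 8.1: l.1140 [Theorem 8.1: Set m ≥ 1. There exists l ≥ m such that if F ∼_l F′, then the formal degree conj. holds for (F, G, φ, π, ψ) if and only if it holds for (F′, G′, φ′, π′, ψ′).]; §9 lists the characteristic-0 inputs and the diagram's suppliers
(quoted in the field and edge below).  The introduction's status sentence treats all four characteristic-0 inputs alike: [The formal degree conj. has been established in many cases for groups over characteristic 0 fields,] l.177 "including $\GL_n$ in \cite{HiragaIchinoKaoru08}, $\SO_{2n+1}$ in \cite{IchinoAtsushietc17}, $\GSp_4$ in \cite{GanIchino14}, and $\Sp_{2n}$ and $\SO_{2n}$ in \cite{beuzartplessis2025}."  THE TYPING.  (5) HYPOTHESIS node `GVffLLC` = the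
commutativity of diagram (LLC_compatibility_DKT) for split Sp_2n, SO_2n, SO_2n+1 (p > 2) « in [GV17, Section 13.6] » = row B96 (R. Ganapathy – S. Varma, J. Inst. Math.
Jussieu 16 (2017) 987–1074), which the cell has NOT read (census `[g15b]`: SECOND-HAND from the zbMATH review, want acq-08153 open; no arXiv version exists): NO
supplier edge is typed; the review (M. Hanzer, Zbl 1398.11079) reads review:L2 "In this paper, the authors prove the local Langlands correspondence for split classical groups over local function fields in the spirit (and using) Arthur's work for these groups in characteristic \(0.\) They have some restrictions on the characteristic in their results. The main tool is, besides Arthur's results, Deligne-Kazhdan philosophy." […] review:L8 "Then, by the work of Arthur, to this \(\pi,\) we can attach a Langlands parameter \(\phi,\)" […] review:L18 "they reformulate Arthur's results (especially the characterization of the representations inside an \(L\)-packet) from the endoscopic formulation to the formulation in terms of \(L,\varepsilon\) and \(\gamma\)-factors for the representations and corresponding Artin factors." […] review:L18 "To do that, they use results of Mœglin about characterization of the representations in one \(L\)-packet in terms of intertwining operators (since the intertwining operators behave well with respect to Kazhdan theory)." — so the node, once B96 is read, should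
receive an edge ⇐ the book (and the Mœglin line); recorded, not typed.  (6) `AKBformalDegreeFF` = Theorem 9.1 ⇐ `ILMcor51` (« [ILM17, Corollary 5.1] ») ∧
`Consumers24.BPformalDegree` (« [BP25, Theorem 1.1] » = row B61, tranche 24 ⇐ book ∧ E41 ∧ A8-p) ∧ `GVffLLC`; [HII08b] (GL_n), [GI14] (GSp_4 = row E47), [Gan15]
(R. Ganapathy, Amer. J. Math. 137 (2015): GL_n / GSp_4 over close fields, on Gan – Takeda's GSp_4 correspondence) are Arthur-free and absorbed.  The paper cites neither
[Art13] nor [Mok15] nor [KMSW] and has no conditionality sentence (census grade G-i, second order).  Examined for this tranche and NOT typed: E. Lapid – Z. Mao, Amer. J.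
Math. 139 (2017) 1–55 = arXiv:1401.0198 (the reduction of the Whittaker – Petersson conj. for Mp_n to a local identity; NEW control row E56): p0003:L10 "In the case of (quasi-split) classical groups, as well as the metaplectic group (i.e.," [… we formulated the conj. without appealing to Arthur's conj. (or work) by using the descent construction of Ginzburg – Rallis – Soudry and the functorial transfer of generic representations by Cogdell – Kim – Piatetski-Shapiro – Shahidi; p0003:L11-14] […] p0003:L22 "In yet another paper joint with Ichino [1404.2909] we will directly relate this local identity in the square-integrable (generic)" [… case to the formal degree conj. of Hiraga – Ichino – Ikeda] — Arthur-free by design, the sentence about « using Arthur's work » announcing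
exactly B119's Corollary 5.1; E. Lapid – Z. Mao, Algebra Number Theory 11 (2017) 713–765 = arXiv:1404.2905 (the Main Identity; 0 classification needles; NEW control row
E57); E. Lapid – Z. Mao, Contemp. Math. 664 (2016) 295–320 = arXiv:1412.4886 (unitary groups: p0003:L68 "Instead, we will take for granted the expected properties of the descent for unitary groups." p0003:L69 "Thus, our results are conditional." — conditional on the
descent theory, not on Mok; NEW control row E58); K. Morimoto, Trans. AMS 370 (2018) 6245–6295, doi:10.1090/tran/7119 (census §I.2 metadata-only direct citer; paywalled,
no arXiv version, acq-04625 open — not read); H. Kakuhama, Represent. Theory 26 (2022) = arXiv:2012.04219 (census §I.4 « peripheral »; its Theorem 1.4, the formal degree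
conj. for the non-split inner forms of Sp_4 / GSp_4, runs on Gan – Tantono / Choiy = row E19, Arthur-free; its status sentence p0005:L29 "It has also been proved for ${\rm SO}_{2n+1}$, ${\rm Mp}_{2n}$, ${\rm U}_n$, and ${\rm Sp}_4$ ( [ILM17], [BP18], [GI14])." is the third printed reading, with B120's l.177 and row B59's use of B61, of B119 / B61 as
« proved »; Henniart – Oi 2023's « already solved » is a fourth).  THE POINT FOR THE CENSUS (kernel; supports to follow in `DownstreamSupport9.lean` §84): support(`ILMcor51`) = the book's 24 leaves (through the
authors' own supplier sentence); support(`ILMnonsplit`) = book 24 ∪ the suppliers of `LLCoddSO` (A8-p / A5: book-only again); support(`AKBformalDegreeFF`) = book 24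
(twice: through B119 and through B61, the latter also through E41 and A8-p) ∪ {the Ganapathy – Varma node}; support(`ILMgeneric`) = ∅.  Mok / KMSW: nothing.  So a
2026 preprint states the formal degree conj. over function fields for split SO_2n+1 / Sp_2n / SO_2n as a theorem whose characteristic-0 inputs are, as their own
authors print them, conditional on the book's local Langlands correspondence — itself resting in 2026 on the unwritten weighted fundamental lemmas and the
2024–2026 preprint layer — with no sentence saying so: one more UNFLAGGED second-order consumer, the first in positive characteristic.

**v2: why an eighty-second tranche — the MR-number citers of the book, II: four arithmetic consumers outside the census.**  Tranche 81 found
Ichino – Lapid – Mao by hand; this tranche ran the systematic version: the held corpus searched for the book's MR number and bibliography line (`lit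
search "3135650"`, `"MR3135650"`, `"Orthogonal and symplectic groups" Colloquium`, …: 147 documents), diffed against the three census files — 31 without a
row, of which 12 are false positives (a bundled `.bib` database containing the book's entry, no citation in the body: arXiv:2508.08648, 2511.11063, 2512.24034,
2602.14121, 2602.16384, 2602.16397, 2602.16398, 2604.11023, 2605.17836, 2606.01206, 2606.01491, 2606.14637; likewise Duan – Wang – Weiss arXiv:2406.03617, whose
body cites none of its three Arthur keys), 4 are typed here, 2 are hypothesis-discharge rows left for the next tranche (M. Sunohara arXiv:2505.04910; D. Hansen –
L. Mann arXiv:2606.00983, whose list of « well-understood » groups cites the book and Ishimoto for SO_2n+1, Mok and KMSW for U_n), and the rest peripheral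
(below).  ROW C206 (NEW): l.3286 "We now recall the existence of Galois representations associated with characteristic zero and characteristic $p$ cohomology classes following \cite{ArthurBook} and \cite{ScholzeTorsion}. These Galois representations all satisfy local-global compatibility for $\ell \not\in S$, as we make precise. In characteristic zero, we prove local-global compatibility at $\ell=p$ for $\tilde{G}(\A)$ in Theorem \ref{Thm:PiCARoftildeGLG}, and recall it for $\GL_n$ in Theorem \ref{Thm:Char0ExistenceOfGalRACAR}." (Theorem (Thm:PiCARoftildeGLG), its proof « By the work of Arthur », Theorem [Scholze] and Theorem D are quoted in the
fields and edges below.)  The Remark after Theorem D: l.460 "    The proof of Theorem \ref{FourthMainThmintroLGcompat} relies on the endoscopic classification for symplectic groups in \cite{ArthurBook}. Although \emph{op.cit.} is still conditional on forthcoming work, there has been a tremendous amount of progress towards making this unconditional in \cite{LocalIntertwiningRelations}. At present, the only thing that remains is the proof of the twisted weighted fundamental lemma."  THE TYPING.  (1) `BGWchar0` =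
Theorem (Thm:PiCARoftildeGLG) ⇐ book (« By the work of Arthur [ArthurBook] »; [ScholzeTorsion, Thm 5.1.2] is cited as an exposition of the same input; BLGGT /
Caraiani's local-global compatibility for GL_{2n+1}, [Tad94], [TaibiEigenvarieties] Arthur-free, absorbed).  (2) `BGWthmD` = Theorem D ⇐ `BGWchar0` ∧ book — the
second premise is the classification input of Scholze's torsion theorem AS THE AUTHORS NAME IT (« relies on Arthur's endscopic classification for symplectic
groups [ArthurBook] »); row C12's field `Consumers.ScholzeTR` is NOT used as the premise because it records Scholze's totally-real-OR-CM sentence, typed ⇐ book ∧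
Mok, while Theorem D lives over ℚ and the authors name the symplectic book only (a premise on `ScholzeTR` would put Mok's 29 leaves into the support by
bookkeeping alone); [YangZhu], [CGHJMRS], [NewtonThorneTorsion], [10author]'s strategy, [ChenevierPadic]: absorbed (their own classification inputs, if any, are
not traced here — [CGHJMRS] is recorded as a candidate).  (3) `BGWthmB` = Theorem B, premise-free (the authors: « completely unconditional »).  (4) `BGWezc` =
Theorems A and C ⇐ `BGWthmD` (Theorem C needs the Galois representation of Theorem D; A = B + C).  Census grade of the row: G-v (the Remark is complete for 2025:
[A25]–[A27] treated as supplied by the AGIKMS preprint, the twisted weighted fundamental lemma named as what remains).  ROW C207 (NEW; the e-print is v2 of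
2025-08-19, « Substantial revision of previous version »; the corpus text is v1): l.260 "Building on Arthur’s work \cite{Arthur2013}, several studies have explored \emph{potential} modularity lifting for $\mathrm{GSpin}_{2n+1}$-valued Galois representations (see, for example, \cite{BoxerCalegariGeePilloni2021,PatrikisTang2022} and the discussion below). These results rely on potential modularity lifting for the unitary group $U_n$ rather than on establishing an $R = \mathbb{T}$ theorem." […] l.327 "Fix an \emph{odd} prime $p$ and an isomorphism $\iota \colon \mathbb{C} \simeq \overline{\mathbb{Q}}_p$. Let $\pi=\otimes_v'\pi_v$ be an irreducible $C$-algebraic automorphic representation of $G(\A_F)$, satisfying certain natural regularity, unramifiedness, and local-global compatibility conditions. Following the work of Arthur and Shin (\cite{Arthur2013,Shin2024}), we associate to $\pi$ a semi-simple Galois representation:" [r_π : Γ_F → ᶜG(ℚ̄_p)].  Theorem 2.3 (the weak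
transfer « By [Shin2024, Corollary 2.5.3] », quoted in the field below) has a one-paragraph proof, the sentence l.995 "The proof of \cite[Corollary 2.5.3]{Shin2024} relies on the assumptions that the weighted fundamental lemma is true for non-split groups and its non-standard version is also true (this is the assumption (H1) in \emph{loc.cit}), which is used to ensure the stabilized trace formula. However, this is already proved in \cite{Arthur2001,Arthur2002,Arthur2003}."  [v1 had instead, at the same place:
p0007:L66 "Shin2024. assumes (C1), which is used to establish Arthur's trace formula. However, by our assumptions (C1), (C2) and (C3), the main result of [Taibi2018] proved this trace formula for the full automorphic spectrum of $G(\mathbb{A}_F)$. Thus [Shin2024] again holds."]  (Theorem 2.6, (C2), Theorems 1.1 / 6.4 and §7 are quoted in the fields and edges below.)  THE TYPING.  (5)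
`XZgalois` = Theorems 2.3 and 2.6 ⇐ row E1's `Shin.WeakS` (S. W. Shin, Essent. Number Theory 3 (2024), Thm 1.1.2 Case S = his Cor. 2.5.3 as cited) ∧ `Shin.GalRepGLN`
(his Step 1, the published GL_N Galois representations; [ChenevierHarris2013], BLGGT, [Taylor2012, Taibi2016, CaraianiLeHung2016] absorbed with it); the author's
(C2) = Shin's (H2) ∧ (H3) is a hypothesis ON π inside the statement, so `Shin.BuzzardGee` (his Thm 1.2.2 = 3.2.7 for Cases S and U jointly) is not the premise —
its Case-U half would drag Mok's and KMSW's stabilisation nodes in by bookkeeping alone.  THE FLAG: the author asserts that (H1) — « the weighted fundamental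
lemma is true for non-split groups and its non-standard version is also true », i.e. exactly the register's two UNWRITTEN leaves `WFL_general`, `WFL_nonstandard`
— « is already proved in [Arthur2001, Arthur2002, Arthur2003] »; Arthur's stable trace formula I–III (2001–2003) is itself conditional on the weighted
fundamental lemma, proved since by Chaudouard – Laumon for SPLIT groups only, and his source says the opposite (row E1, `Downstream.lean`: « the WFL for Lie
algebras remains to be verified for nonsplit groups. The nonstandard WFL is open at this time »).  Census grade: G-ii-type (an open leaf treated as
established), first order.  (6) `XZRT` = Theorem 1.1 (= Theorems 6.4 / 6.5) ⇐ `XZgalois` (the Galois representations r_π and ρ̄_𝔪 are the classification's only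
entry into §§3–6: no [Arthur2013] / [Taibi2018] / [Shin2024] citation between l.1141 and l.10651).  (7) `XZBK` = Theorems 7.5 / 7.6 (= Theorem 1.5) ⇐ `XZRT` ∧
`Consumers.TaibiInner` (row A3: « [Taibi2018, Theorem 4.0.1] » multiplicity one for the definite G, ⇐ book ∧ StabInner ∧ AMR by tranche 1) ∧ book (« [Arthur2013,
Theorem 1.5.3(a)] »).  ROW C208 (NEW; G. Boxer – V. Pilloni, *Higher Coleman Theory*, arXiv:2110.10251v1, 2021-10-19, 5461 TeX lines; PREPRINT): §1.4 l.339 "Finally, using point $(4)$ we can give a new construction of Galois representations associated to certain automorphic representations realizing in the coherent cohomology of Shimura varieties, but not in the Betti cohomology. This construction is via $p$-adic interpolation, and yields new results on local-global compatibility at $p$.  In \cite{F-Pilloni}, section 9, we defined a certain class of cuspidal automorphic representations for the group $\mathrm{GL}_n/L$ where $L$ is a totally real or CM number field.  These are called weakly regular, odd, algebraic, essentially (conjugate) self dual, cuspidal automorphic representations." (The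
Theorem — §1.4, l.341-355, restated §6.11, l.5433-5447 — and its proof are quoted in the field and edge below.)  The authors' Remark: l.362 "\begin{rem} As explained, our proof of this theorem  makes use of the results of \cite{MR3338302} to descend certain automorphic representations  to quasi-split unitary groups, and is therefore conditional on the results announced in  \cite{MR3135650}." [end of
Remark.]  THE TYPING.  (8) `BPweakRegLGC` = that Theorem ⇐ Mok
(« the results of [MR3338302] », the descent to quasi-split U(n): `∀ N, μ.Everything N`) ∧ `Consumers74.FPWeaklyRegular` (row C141 = [F-Pilloni] = Fakhruddin –
Pilloni, J. Inst. Math. Jussieu 22 (2023), Thms 9.10 / 9.11, typed in tranche 74 ⇐ Mok) — the pattern of row C140 (Berger – Weiss ⇐ Mok ∧ C141); Kisin, Jorza –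
Mok, [MR3512528] / [MR3989256] (the earlier constructions), the paper's own eigenvariety: Arthur-free, absorbed.  Census grade: G-iii-type (a flag naming « the
results announced in [MR3135650] » — the book's unpublished references —, not the weighted fundamental lemma; KMSW not involved: quasi-split U(n) only).  ROW
C209 (NEW; PUBLISHED 2024): p0001:L8-10 "Mod p local-global compatibility for GSp4 .Qp / in the ordinary case John Enns and Heejong Lee" — §1: p0005:L39-41 "by choosing the same Taylor–Wiles datum and ultrafilter. In order to attach Galois representations to a regular algebraic cuspidal automorphic representation of G , we need to apply Jacquet–Langlands for GSp4 proven in [52] under stable and tempered assumptions. In Lemma 4.1.7, we show that automorphic representations of G of our concern are indeed stable and tempered by using various results on Arthur multiplicity formula" [[2, 28, 54].]  §4.1: p0037:L7 "This classification was proven in [28], conditional on unpublished results of" p0037:L8 "Arthur, Moeglin and Waldspurger. We freely use consequences of the classification below." (Theorem 4.5.1, Corollary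
4.1.1, Lemma 4.1.7 and their uses are quoted in the fields and edges below.)  THE TYPING.  (9)
`ELstableTempered` = Corollary 4.1.1 ∧ Lemma 4.1.7 ⇐ book (« [2] ») ∧ `Consumers.GeeTaibi` (row A4 = « [28] », Arthur's multiplicity formula for GSp_4 ⇐ book ∧
the similitude stabilisations ∧ [MW I 4.11], tranche 1) ∧ `Consumers.TaibiInner` (row A3 = « [54] ») — the three references of the authors' own sentence « various
results on Arthur multiplicity formula [2, 28, 54] »; « [6, Theorem 2.9.3] » = row C9 Boxer – Calegari – Gee – Pilloni's summary of the GSp_4 classification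
(itself from [28]) and « [1] » = Arthur's 2004 announcement: absorbed into the A4 premise; « [52] » = C. Sorensen, J. Inst. Math. Jussieu 8 (2009) (Jacquet –
Langlands for GSp_4 under stable-tempered hypotheses): Arthur-free, absorbed.  (10) `ELmain` = Theorem 4.5.1 (the paper's main theorem; abstract quoted in the
field) ⇐ `ELstableTempered` (used at p0041:L47 and p0048:L15 to apply [52]).  Census grade: G-iii (the flag names « unpublished results of Arthur, Moeglin and
Waldspurger » — the book's unpublished references; not the weighted fundamental lemma; « We freely use consequences of the classification below »).  EXAMINED,
NOT TYPED (census only): P. Yan, arXiv:2508.09066 (2025; Rankin – Selberg integrals for GSpin, global Gan – Gross – Prasad for generic representations — NEW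
CONTROL row E59, Arthur-free by design: p0005:L2 "However, the endoscopic classification for $\GSpin$ groups is not available. As a result, our Theorem (intro-thm-global-GGP) is limited to generic representations." p0005:L3 "To remedy the lack of endoscopic classification, we use the Langlands functorial transfer for generic representations of $\GSpin$ groups established by Asgari and Shahidi" […]); T. Finis – E. Lapid – W. Müller, J. Inst. Math. Jussieu (2015) =
arXiv:1208.2257 (limit multiplicities; peripheral: p0020:L31-32 "It is possible that for classical groups these properties are within reach using the work of Arthur [MR3135650] and Mœglin [MR2925174], and the same may apply to the exceptional group $G_2$ [MR1726704]."); N. C. Addanki, arXiv:2412.09738 (2024; signs of Hecke eigenvalues of genus-2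
Siegel forms; second-hand through R. Schmidt 2018 and a citation of the book's « Theorem 1.3.2 » for SO_5: p0004:L16 "Using the exceptional isomorphism, $\mr{PGSp}_4(\mb{A_Q}) \cong \mr{SO}_5(\mb{A_Q})$, $\pi_F$ can be extended to a representation of $\mr{SO}_5(\mb{A_Q})$. Hence, given $F$, we can attach a representation of $\mr{SO}_5(\mb{A_Q}).$ Theorem $1.3.2$ of [MR3135650] gives a classification of all such representations." — peripheral, no theorem traced to the classification beyond the type sorting); H. Hahn,
arXiv:1509.01863 (2015; a remark, in the `--` comment below; peripheral); D. Jiang – B. Liu, Pacific J. Math. 281 (2016) 421–466 = arXiv:1412.7548 (listed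
unexamined in census §I.34; a CONSUMER — p0169:L8-9 "Theorem 1.1 [Arthur 2013, Theorem 1.5.2]. For each global Arthur parameter z 2 .Sp2n /, there exists a global Arthur packet …" [of Sp_2n(𝔸) …] — left as a candidate C-row for the next tranche, with the two hypothesis-discharge
rows above); P. Mezo, J. Inst. Math. Jussieu (2016) doi:10.1017/s1474748014000437 (twisted spectral transfer for real groups: UPSTREAM of the book, not downstream);
A. Pantano – A. Paul – S. Salamanca-Riba, Pacific J. Math. 271 (2014) and J. Achter – C. Cunningham, Pacific J. Math. 273 (2015) (the book in concluding remarks: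
peripheral); doi:10.17863/cam-39690 (*Level raising for automorphic representations of GL(2n)*, 2019: not held, paywalled — acq-09811 filed by the read attempt, not
examined).  THE POINT FOR THE CENSUS (kernel; supports to follow in `DownstreamSupport9.lean` §85): as typed, support(`BGWezc`) = support(`BGWthmD`) = the book's 24
leaves; support(`BGWthmB`) = ∅; support(`XZgalois`) = support(`XZRT`) = the NINE leaves of Shin's weak transfer (FL, WFL_split, W4_Thm38, STF_Arthur, TwistedTF,
MW_Stab, SpecGLN, WFL_general, WFL_nonstandard — `shin_weakS_support`), of which the author declares the two unwritten ones « already proved »; support(`XZBK`) =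
all 24 (through Taïbi and Theorem 1.5.3); support(`BPweakRegLGC`) = Mok's 29 leaves, nothing of the book or KMSW as typed (the authors' flag names the book's
announced references — through Mok's dependence on them); support(`ELmain`) = the book's 24 leaves (through A4 and A3).  Four more consumers, three of them
2024–2025 arithmetic papers with R = 𝕋 / local-global compatibility theorems, each resting on the unwritten weighted fundamental lemmas; one says so exactly
(C206), one names the book's announced references (C208, C209 similarly), and one asserts the open leaves are proved (C207).  Bib keys
BarreraGrahamWilliams2025LGCEZC, XZhang2024TaylorWilesOrthogonal, EnnsLee2024ModpLGCGSp4 added by this unit (commit 09ac964b1f65); BoxerPilloni2021HigherColeman,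
Shin2024, Taibi2018, GeeTaibi2019, Scholze2015, FakhruddinPilloni2023Hecke, AGIKMS2024 exist.

**Deliberately not here.**  Any claim about formal degrees, Plancherel measures, adjoint γ-factors, the Hiraga – Ichino – Ikeda conj. itself, the descent
method, theta correspondences, the Deligne – Kazhdan theory of close local fields, Kazhdan's Hecke-algebra isomorphisms, Bruhat – Tits theory or motives:
published and Arthur-free, or the papers' own subject, absorbed or recorded by locator (v2 likewise: p-adic L-functions, 𝓛-invariants, eigenvarieties, higher Coleman theory, Taylor – Wiles patching, deformation rings, mod p local Langlands, Fontaine – Laffaille theory); no Mathlib, no `axiom`, no `sorry`, no `opaque`.  Bib keys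
IchinoLapidMao2017, AnanthaKrishna2026FDCFunctionFields, GanIchino2014FormalDegrees, LapidMao2017MetaplecticII added by this unit; BeuzartPlessis2025FDC (B61),
GanSavin2012MetaplecticI (B112), GanapathyVarma2017 (B96), Ishimoto2020LIRMp, MoeglinRenard2018, Arthur2013, Mok2012 exist.
-/

set_option autoImplicit false

namespace Literature.NumberTheory.Automorphic.Arthur2013

namespace Downstream

/-! ## Eighty-first tranche (v4, unit `pub-arthur-down-g33`): THE FORMAL DEGREE LINE — NEW row B119 `ILMllcSO` (hypothesis field) / `ILMgeneric` /
`ILMcor51` / `ILMnonsplit`; NEW row B120 `GVffLLC` (node, row B96 second-hand) / `AKBformalDegreeFF`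

Context (Ichino – Lapid – Mao, Duke Math. J. 166 (2017) = arXiv:1404.2909 and Anantha Krishna B, arXiv:2605.26031 both ABSENT from `DOWNSTREAM.md` /
`DOWNSTREAM2.md` / `DOWNSTREAM3.md` — NEW rows B119, B120, block `[g33]` of `DOWNSTREAM3.md`; typed premises reused: `Consumers57.LLCoddSO` (tranche 57's node
« the local Langlands correspondence for SO(V^±) », with its supply edges `E_LLCoddSO_of_MR` / `E_oddSOHyps_of_Ishimoto`), `Consumers24.BPformalDegree` (row B61,
tranche 24), `BookInputs`).  Texts under `HOME/pub-arthur-down-g33/primaries/`: `src-1404.2909v2/formalsubmission240714.tex` (three authors l.93 "\author{Atsushi Ichino}" l.96 "\author{Erez Lapid}" l.99 "\author{Zhengyu Mao}"),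
`src-2605.26031v1/formaldegree.tex` (l.143 "\author{Anantha Krishna B}" l.144 "\affil{Department of Mathematics, Indian Institute of Science, Bengaluru, India"), `zbmath-1398.11079/review.txt` (row B96's review); the bibliography entries relied on are in the `--`
comments below.  Loci: B119 l.109, l.160-183, l.185-193, l.338-344, l.539-579, l.1150-1181, l.1185-1233, l.1235-1261,
l.1263-1302, l.1800-1803; B120 l.143-144, l.163-165, l.176-177, l.262-271, l.1120, l.1140-1142, l.1185-1228, l.1235, l.1245-1249, l.1319-1322, l.1349-1352. -/

/-- NEW rows B119 (Ichino – Lapid – Mao 2017: a hypothesis field, the unconditional theorems, Corollary 5.1, the non-split reduction) and B120 (Anantha Krishna B 2026: a hypothesis node and Theorem 9.1) of the census, as an arbitrary assignment of propositions; nothing about the content of a field is assumed. [cite: Arthur2013, downstream register of the cell, eighty-first tranche (structure only)] -/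
structure Consumers81 where
  /-- B119, THE HYPOTHESIS OF COROLLARY 5.1 as §5 spells it out (`src-1404.2909v2/formalsubmission240714.tex`): l.1187 "The local Langlands correspondence (in the square-integrable case) asserts that there exists a partition" [Irr_sqr SO(2n+1) = ∐_φ Π_φ over square-integrable L-parameters φ : WD_F → Sp_n(ℂ)] […] l.1195 "Moreover, there exists a bijection" [Π_φ → the characters of 𝒮_φ = S_φ / {± I_2n}] […] l.1202 "The above bijection satisfies the following properties." […] l.1217 "Then $\Theta^{\mathrm{st}}_{\phi'}$ is a stable distribution and $\Theta_{\phi}^s$ is the transfer of $\Theta^{\mathrm{st}}_{\phi'}$, i.e.," [(eq: transfer)] […] l.1223 "(see \cite[\S 1.4]{MR909227}, \cite[\S 5.5]{MR1687096}; see also \cite[\S 5.3]{MR1687096}, \cite[\S 2.1]{MR3135650} for the normalization of transfer factors)." — together with the two facts the proof of Corollary 5.1 takes from the same source: [from (eq: transfer) and [MR1070599, Cor. 9.10]: Σ_{σ ∈ Π_φ} ⟨s, σ⟩ d_σ = 0 for s ≠ 1, so the formal degree is constant on Π_φ;] l.1243 "Hence, to prove the corollary, we may assume that the character $\sprod{\cdot}{\sigma}$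 is trivial." l.1244 "Then by \cite[Proposition 8.3.2]{MR3135650}, $\sigma$ is generic." l.1245 "In fact, as explained in the proof of [loc.~cit.]," l.1246 "there exist a number field $k$, a place $v_0$ of $k$," l.1247 "an automorphic representation $\Pi$ of $\GL_{2n}(\A_k)$," l.1248 "and an irreducible globally generic cuspidal automorphic representation $\Sigma$ of $\SO(2n+1,\A_k)$ such that" [k_{v_0} = F, Π_{v_0} ↔ ι ∘ φ, Σ lifts weakly to Π, Σ_{v_0} = σ] l.1256 "On the other hand, by \cite[Theorem E]{MR2058617}," [Π_{v_0} = JS(Σ_{v_0})] l.1261 "This reduces the corollary to Theorem \ref{thm: so}."  The authors' attribution (the SUPPLIER sentences): [§5 opens: « We now prove the formal degree conj. for SO(2n+1), under the assumption of the local Langlands correspondence, »] l.1186 "which was established by Arthur \cite{MR3135650} conditionally on the stabilization of the twisted trace formula." and, in the introduction, l.185 "Under the local Langlands correspondence for $\SO(2n+1)$, which would follow from Arthur's work \cite{MR3135650} once its" l.186 "prerequisites are established," [we get the formal degree conj. for SO(2n+1) (as well as for Mp_n) in full generality in §5.] [cite: IchinoLapidMao2017, §5 (e-print v2 l.1185-1223)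 with the proof of Cor. 5.1 (l.1235-1261) and §1 (l.185-187)] -/
  ILMllcSO : Prop
  /-- B119, THE UNCONDITIONAL THEOREMS (Arthur-free): Theorem 2.1 l.338 "\begin{theorem} \label{thm: GLn}" l.339 "Let $\pi \in \Irr_{\sqr} \GL_n$ and let $d_{\pi}$ be its formal degree." [Then d_ψ = n ω_π(−1)^{n−1} γ^{an}(1, π, Ad, ψ) d_π = n ω_π(−1)^{n−1} γ^{ari}(1, π, Ad, ψ) d_π.]; Theorem 3.3 l.572 "\begin{theorem} \label{thm: Mpn}" l.573 "Assume that $\pi\in\Irr_{\msqr}\GL_{2n}$ is of the form \eqref{eq: pi}." l.574 "Let $\tilde \pi = \des_{\psi^{-1}}(\pi)\in \Irr_{\sqr,\genpsi{\psi_{\tilde N}^{-1}}}\Mp_n$ and let $d_{\tilde \pi}$ be its formal degree" l.575 "(as a Haar measure on $\Sp_n$). Then" [d_ψ^{Sp_n} = |2|^n 2^k γ^{an}(1, π, Sym², ψ) d_π̃ = |2|^n 2^k γ^{ari}(1, π, Sym², ψ) d_π̃] [π = π_1 × ⋯ × π_k ∈ Irr_msqr GL_2n, the descent bijection des_ψ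 : Irr_msqr GL_2n → Irr_{sqr, ψ-gen} Mp_n of Theorem 3.1]; Theorem 4.7 [its heading sentence: the formal degree conj. for SO(2n+1) in the generic case] l.1156 "\label{thm: so}" l.1157 "Let $\sigma\in\Irr_{\sqr,\gen}\SO(2n+1)$ and let $d_\sigma$ be its formal degree." l.1158 "Assume that $\pi = \JSlift(\sigma)$ is of the form \eqref{eq: pi}." [Then d_ψ^{SO(2n+1)} = 2^k γ^{an}(1, π, Sym², ψ) d_σ = 2^k γ^{ari}(1, π, Sym², ψ) d_σ] — proof: l.1167 "By \cite[Theorem 15.1]{MR3166215}, we have" [d_π̃ / d_ψ^{Sp_n} = c · d_σ / d_ψ^{SO(2n+1)}] […] l.1174 "Thus it follows from Theorem \ref{thm: Mpn} that"  Inputs: l.160 "The work of Jiang--Soudry \cite{MR1983781, MR2058617}, which is based on the descent method of Ginzburg--Rallis--Soudry \cite{MR1671452, MR1954940, MR2848523}," […] l.172 "The proof is based on the Main Identity of the second and third named authors \cite{1404.2905}." […] l.177 "Using the above result for $\Mp_n$ and the result of \cite{MR3166215} we conclude that for any $\sigma\in\Irr_{\sqr,\gen}\SO(2n+1)$" [(eq: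 so2n+1)] […] l.183 "the theta correspondence due to Gan--Savin \cite{MR2999299}." l.552 "We now quote a corollary of the main result of \cite{1404.2905}." l.553 "\begin{theorem}[{\cite[Corollary 3.4]{1404.2905}}] \label{thm: main}" [cite: IchinoLapidMao2017, Thm 2.1 = thm: GLn (l.338-344), Thm 3.1 = thm: bijection (l.539), Thm 3.2 = thm: main (l.553), Thm 3.3 = thm: Mpn (l.572-579), Thm 4.7 = thm: so (l.1155-1163); LapidMao2017MetaplecticII, Cor. 3.4 (as cited); GanIchino2014FormalDegrees, Thm 15.1 (as cited)] -/
  ILMgeneric : Prop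
  /-- B119 (NEW census row, block `[g33]` of `DOWNSTREAM3.md`; census grade G-ii: the status sentence names the stabilisation of the twisted trace formula only): Atsushi Ichino – Erez Lapid – Zhengyu Mao, *On the formal degrees of square-integrable representations of odd special orthogonal and metaplectic groups*, Duke Math. J. 166 (2017), no. 7, 1301–1348, doi:10.1215/00127094-0000001X = arXiv:1404.2909 — COROLLARY 5.1, ITS CONCLUSION (the statement as printed opens « If we admit the local Langlands correspondence for SO(2n+1), then » — field `ILMllcSO`): l.1226 "\label{cor: nongen}" [If we admit the local Langlands correspondence for SO(2n+1), then the formal degree conj. holds for SO(2n+1).] l.1228 "Namely, we have" [d_ψ^{SO(2n+1)} = |S_φ| γ^{ari}(1, σ, Ad, ψ) d_σ] l.1232 "for any square-integrable $L$-parameter $\phi: \WD_F \rightarrow \Sp_n(\C)$ and any $\sigma \in \Pi_\phi$." [cite: IchinoLapidMao2017, Cor. 5.1 = cor: nongen (e-print v2 l.1225-1233; corpus `paper-arxiv-1404.2909` p0016:L53-62)] -/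
  ILMcor51 : Prop
  /-- B119, THE NON-SPLIT GROUP: the conclusion of the §5 closing reduction — the formal degree conj. for the square-integrable representations of the non-split SO(2n+1)^- — stated by the authors as a sketch under an admitted joint local Langlands correspondence for SO(2n+1)^±: l.1264 "Now let $\SO(2n+1)^-$ be the non-split special orthogonal group in $2n+1$ variables." [We will explain how to prove the formal degree conj. for SO(2n+1)^- if we admit the local Langlands correspondence (cf. [WaldAst3472, §4.2]).] l.1268 "The local Langlands correspondence (in the square-integrable case) asserts that there exist a partition" [Irr_sqr SO(2n+1)^+ ∐ Irr_sqr SO(2n+1)^- = ∐_φ Π_φ, Π_φ → characters of S_φ] […] l.1284 "Then $\Pi_\phi^\pm = \Pi_\phi \cap \Irr_{\sqr} \SO(2n+1)^\pm$, and the endoscopic character relations hold (see \cite[\S 4.2 and \S 4.8]{WaldAst3472})." [… the Steinberg formal degrees [MR2425185] force c = 1 …] l.1300 "Also, as in the proof of Corollary \ref{cor: nongen}, the other endoscopic character relations imply that the representations" l.1301 "in $\Pi_\phi^-$ have the same formal degree." [These allow us to reduce the formal degree conj. for SO(2n+1)^- to that for SO(2n+1)^+.] With, in the introduction: l.191 "Similarly,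 a similar statement for non-split $\SO(2n+1)$ would follow from results announced by Arthur." [cite: IchinoLapidMao2017, §5 after Cor. 5.1 (e-print v2 l.1263-1302), §1 (l.193)] -/
  ILMnonsplit : Prop
  /-- HYPOTHESIS node, row B120 (= row B96 of `DOWNSTREAM.md` l.784 `[g15b]`, SECOND-HAND — the paper R. Ganapathy – S. Varma, *On the local Langlands correspondence for split classical groups over local function fields*, J. Inst. Math. Jussieu 16 (2017) 987–1074, doi:10.1017/s147474801500033x, is NOT held by the cell: acq-08153 open, no arXiv version; NO supplier edge typed): the compatibility of the local Langlands correspondence for split Sp_2n, SO_2n, SO_2n+1 (p > 2) with the Deligne – Kazhdan correspondence over close local fields, AS ROW B120 STATES AND USES IT — §8: l.1120 "For the rest of the section, we assume there exists $l \ge m$ with $F \sim_l F'$ such that $\Kaz_m \colon \Pi(G,F)_m \to \Pi(G',F')_m$ is a bijection, and that the following diagram commutes:" [(LLC_compatibility_DKT): LLC ∘ Kaz_m = Del_m ∘ LLC on depth ≤ m] l.1131 "\end{equation} and the following equality holds:" [dim ρ_π = dim ρ_π′] §9: l.1185 "In this section, let $G$ be one of the following split groups over $F$ of characteristic $p > 0$:"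 [GL_n; Sp_2n, SO_2n, SO_2n+1 with p > 2; GSp_4 with p > 2] l.1193 "The commutativity of Diagram~\ref{LLC_compatibility_DKT} can be established as follows. In the following papers, the commutativity of the diagram below is established:" l.1195 "    \item for $\GL_n$, in~\cite[Section 7]{Ganapathy15};" l.1196 "    \item for $\GSp_4$ ($p > 2$), in~\cite[Section 9.3]{Ganapathy15};" l.1197 "    \item for $\Sp_{2n}$, $\SO_{2n}$, and $\mathrm{SO}_{2n+1}$ ($p>2$), in~\cite[Section 13.6]{GanapathyVarma17}."  What the cell knows of B96 (zbMATH review by M. Hanzer, `zbmath-1398.11079/review.txt`): review:L2 "In this paper, the authors prove the local Langlands correspondence for split classical groups over local function fields in the spirit (and using) Arthur's work for these groups in characteristic \(0.\) They have some restrictions on the characteristic in their results. The main tool is, besides Arthur's results, Deligne-Kazhdan philosophy." […] review:L8 "Then, by the work of Arthur, to this \(\pi,\) we can attach a Langlands parameter \(\phi,\)" […] review:L18 "they reformulate Arthur's results (especially the characterization of the representations inside an \(L\)-packet) from the endoscopic formulation to the formulation in terms of \(L,\varepsilon\) and \(\gamma\)-factors for the representations and corresponding Artin factors." […] review:L18 "To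 do that, they use results of Mœglin about characterization of the representations in one \(L\)-packet in terms of intertwining operators (since the intertwining operators behave well with respect to Kazhdan theory)." [cite: AnanthaKrishna2026FDCFunctionFields, §8 (e-print v1 l.1120), §9 (l.1185-1196); GanapathyVarma2017, §13.6 (as cited; unread, Zbl 1398.11079)] -/
  GVffLLC : Prop
  /-- B120 (NEW census row, block `[g33]`; census grade G-i, second order: no classification citation, no conditionality sentence): Anantha Krishna B, *The formal degree conj. for groups over local function fields* (title word abbreviated), arXiv:2605.26031 (v1 2026-05-25; PREPRINT; `src-2605.26031v1/formaldegree.tex`) — THEOREM 9.1 (the exact form of Theorem 1.1): l.1185 "In this section, let $G$ be one of the following split groups over $F$ of characteristic $p > 0$:" [GL_n; Sp_2n, SO_2n, SO_2n+1 with p > 2; GSp_4 with p > 2] l.1193 "The commutativity of Diagram~\ref{LLC_compatibility_DKT} can be established as follows. In the following papers, the commutativity of the diagram below is established:" l.1195 "    \item for $\GL_n$, in~\cite[Section 7]{Ganapathy15};" l.1196 "    \item for $\GSp_4$ ($p > 2$), in~\cite[Section 9.3]{Ganapathy15};" l.1197 "    \item for $\Sp_{2n}$, $\SO_{2n}$,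 and $\mathrm{SO}_{2n+1}$ ($p>2$), in~\cite[Section 13.6]{GanapathyVarma17}." [… G split over F of characteristic p > 0: GL_n; Sp_2n, SO_2n, SO_2n+1 (p > 2); GSp_4 (p > 2)] l.1224 "\begin{theorem}\label{thm:Formal_deg_over_function_field}" l.1225 "    Let $\varphi$ be a discrete parameter. Let $\pi \in \Pi^2_{\varphi}(G,F)$. Then " [d(π, μ_{Z∖G}) = |γ(φ)| / #𝒮_φ^♯]  Theorem 1.1 (loose version): l.262 "\begin{theorem}[Loose version]" [Let F be a local field with char(F) = p > 0. Then the formal degree conj. holds for discrete series representations of following split groups defined over F:] l.264 "        \item $\GL_n,$" l.265 "        \item $\GSp_4 (p > 2),$" l.266 "        \item $\Sp_{2n}, \SO_{2n},$ and $\SO_{2n+1} (p >2).$" [cite: AnanthaKrishna2026FDCFunctionFields, Thm 9.1 = thm:Formal_deg_over_function_field (e-print v1 l.1224-1228), Thm 1.1 (l.262-271), §9 (l.1185-1190)] -/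
  AKBformalDegreeFF : Prop

variable (ν : Nodes) (μ : Mok2015.Nodes) (κ : KMSW2014.Nodes) (c : Consumers) (c₂ : Consumers2) (c₅ : Consumers5) (c₁₁ : Consumers11) (c₁₂ : Consumers12)
  (c₁₃ : Consumers13) (c₁₄ : Consumers14) (c₂₄ : Consumers24) (c₅₇ : Consumers57) (c₈₁ : Consumers81)

-- Verbatim, the sentences that name a conj. (kept out of docstrings by the register's lint), from `src-1404.2909v2/formalsubmission240714.tex` (row B119):
-- abstract: l.109 "In this paper, we prove the formal degree conjecture for odd special orthogonal and metaplectic groups in the generic case, which combined with Arthur's work on the local Langlands correspondence implies the conjecture in full generality."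
-- §1: l.185 "Under the local Langlands correspondence for $\SO(2n+1)$, which would follow from Arthur's work \cite{MR3135650} once its" / l.186 "prerequisites are established," / l.187 "we get the formal degree conjecture for $\SO(2n+1)$ (as well as for $\Mp_n$) in full generality in \S\ref{sec: odd general}."
-- §5, opening: l.1185 "We now prove the formal degree conjecture for $\SO(2n+1)$, under the assumption of the local Langlands correspondence," / l.1186 "which was established by Arthur \cite{MR3135650} conditionally on the stabilization of the twisted trace formula."
-- Corollary 5.1, first sentence: l.1227 "If we admit the local Langlands correspondence for $\SO(2n+1)$, then the formal degree conjecture holds for $\SO(2n+1)$."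
-- §5, the non-split group: l.1265 "We will explain how to prove the formal degree conjecture for $\SO(2n+1)^-$ if we admit the local Langlands correspondence (cf.~\cite[\S 4.2]{WaldAst3472})." / l.1302 "These allow us to reduce to the formal degree conjecture for $\SO(2n+1)^-$ to that for $\SO(2n+1)^+$."
-- §4, before Theorem 4.7: l.1151 "Finally, we prove the formal degree conjecture for $\SO(2n+1)$ in the generic case."
-- From `src-2605.26031v1/formaldegree.tex` (row B120): abstract: l.163 "    In this article, we will prove that the formal degree conjecture is compatible with the Deligne-Kazhdan correspondence for quasi-split groups, assuming that the local Langlands correspondence is compatible with the Deligne-Kazhdan correspondence. Consequently, we establish the formal degree conjecture for $\GL_n$ over local" / l.164 "    function fields of characteristic $p > 0$, and for $\Sp_{2n}$, split $\SO_{2n}$," / l.165 "    $\SO_{2n+1}$, and $\GSp_4$ over local function fields of characteristic $p > 2$."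
-- §1: l.177 "The formal degree conjecture has been established in many cases for groups over characteristic $0$ fields, including $\GL_n$ in \cite{HiragaIchinoKaoru08}, $\SO_{2n+1}$ in \cite{IchinoAtsushietc17}, $\GSp_4$ in \cite{GanIchino14}, and $\Sp_{2n}$ and $\SO_{2n}$ in \cite{beuzartplessis2025}."
-- Theorem 1.1: l.263 "    Let $F$ be a local field with $\Char(F) = p > 0.$ Then the formal degree conjecture holds for discrete series representations of following split groups defined over $F$\begin{itemize}"
-- §8, opening: l.1120 "The aim of this section is to prove that the formal degree conjecture holds if the Deligne-Kazhdan theory of close local fields is compatible with the LLC. Let $\Pi(G,F)_m$ be the set of isomorphism classes of representations $\pi$ of $G(F)$ such that $\depth(\pi) \le m$. Let $\Pi^2(G,F)_m$ be the set of discrete series representations in $\Pi(G,F)_m$. For the rest of the section, we assume there exists $l \ge m$ with $F \sim_l F'$ such that $\Kaz_m \colon \Pi(G,F)_m \to \Pi(G',F')_m$ is a bijection, and that the following diagram commutes:"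
-- Theorem 8.1: l.1141 "    Set $m \ge 1$. There exists $l \ge m$ such that if $F \sim_l F'$, then the formal degree conjecture holds for $(F, G, \varphi, \pi, \psi)$ if and only if it holds for $(F', G', \varphi', \pi', \psi')$."
-- Row E56 (control), corpus `paper-arxiv-1401.0198`: p0003:L11 "the metaplectic double cover of the symplectic group) we formulated the conjecture without appealing to Arthur's" / p0003:L24 "Thereby, using Arthur's work and the work of Gan–Ichino [MR3166215] we will establish the formal degree conjecture"
-- Status witness (no row), G. Henniart – M. Oi arXiv:2307.15248, corpus `paper-arxiv-2307.15248`: p0020:L45-46 "Conjecture 4.1 in this case has been already solved ([ILM17] for SO 2n+1 and [BP21] for SO 2n and Sp 2n). Suppose that an L-parameter φ is given “explicitly” in the"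
-- Bibliography entries: B119's [MR3135650] = l.1800 "\bibitem[Art13]{MR3135650}" l.1801 "James Arthur, \emph{The endoscopic classification of representations}, American" l.1802 "  Mathematical Society Colloquium Publications, vol.~61, American Mathematical" l.1803 "  Society, Providence, RI, 2013, Orthogonal and symplectic groups. \MR{3135650}"
-- B120's [ILM17] = l.1349 "\bibitem[ILM17]{IchinoAtsushietc17}" l.1351 "\newblock On the formal degrees of square-integrable representations of odd special orthogonal and metaplectic groups." l.1352 "\newblock {\em Duke Math. J.}, 166(7):1301--1348, 2017."
-- B120's [GV17] = l.1319 "\bibitem[GV17]{GanapathyVarma17}" l.1321 "\newblock On the local {L}anglands correspondence for split classical groups over local function fields." l.1322 "\newblock {\em J. Inst. Math. Jussieu}, 16(5):987--1074, 2017."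
-- B120's [BP25] = l.1245 "\bibitem[BP25]{beuzartplessis2025}" l.1247 "\newblock The Hiraga--Ichino--Ikeda conjecture on formal degrees for classical groups." l.1248 "\newblock \emph{arXiv preprint} arXiv:2508.08470, 2025."

/-- SUPPLY EDGE FOR THE HYPOTHESIS FIELD `ILMllcSO`, typed from the authors' own attribution (`src-1404.2909v2/formalsubmission240714.tex`): §5 [§5 opens: « We now prove the formal degree conj. for SO(2n+1), under the assumption of the local Langlands correspondence, »] l.1186 "which was established by Arthur \cite{MR3135650} conditionally on the stabilization of the twisted trace formula." §1 l.185 "Under the local Langlands correspondence for $\SO(2n+1)$, which would follow from Arthur's work \cite{MR3135650} once its" l.186 "prerequisites are established," [we get the formal degree conj. for SO(2n+1) (as well as for Mp_n) in full generality in §5.] — and the two places of the proof of Corollary 5.1 that cite [MR3135650] directly (Proposition 8.3.2; the globalisation « as explained in the proof of [loc. cit.] ») plus §5's « [MR3135650, §2.1] for the normalization of transfer factors » — [MR3135650] = [Art13], the book (bibliography entry in the `--` comment above) ↦ the book at all ranks, `∀ N, ν.Everything N` (Theorems 1.5.1 / 2.2.1 for the split SO(2n+1), all n).  The authors' status words: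 « would follow from Arthur's work once its prerequisites are established » (2014/2017) and « established by Arthur conditionally on the stabilization of the twisted trace formula » — the stabilisation only (census grade G-ii).  Premise: the book. [cite: IchinoLapidMao2017, §1 (l.185-187), §5 (l.1185-1186, l.1223, l.1244-1245); Arthur2013, Thms 1.5.1 / 2.2.1, Prop. 8.3.2 (as cited)] -/
def E_ILMllcSO : Prop := (∀ N, ν.Everything N) → c₈₁.ILMllcSO

/-- B119's THEOREMS 2.1 / 3.3 / 4.7, PREMISE-FREE: published (Duke Math. J. 2017) and Arthur-free by the authors' own account — l.160 "The work of Jiang--Soudry \cite{MR1983781, MR2058617}, which is based on the descent method of Ginzburg--Rallis--Soudry \cite{MR1671452, MR1954940, MR2848523}," […] l.172 "The proof is based on the Main Identity of the second and third named authors \cite{1404.2905}." […] l.177 "Using the above result for $\Mp_n$ and the result of \cite{MR3166215} we conclude that for any $\sigma\in\Irr_{\sqr,\gen}\SO(2n+1)$" [(eq: so2n+1)] […] l.183 "the theta correspondence due to Gan--Savin \cite{MR2999299}." [MR2058617] = Jiang – Soudry 2004, [1404.2905] = Lapid – Mao's Main Identity (row E57, control), [MR3166215] = Gan – Ichino, Invent.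 Math. 195 (2014) (row E47, control), [MR2999299] = Gan – Savin 2012 (row B112's Arthur-free theorems; its Cor. 1.2 under `LLCoddSO` is not used here); §4's footnote records that the Jiang – Soudry results are proved independently of the local Langlands correspondence.  No premise. [cite: IchinoLapidMao2017, Thms 2.1, 3.3, 4.7 with §1 (l.160-183); GanIchino2014FormalDegrees, Thm 15.1; LapidMao2017MetaplecticII, Cor. 3.4; GanSavin2012MetaplecticI, Thm 8.1, Cor. 6.4 (as cited l.764, l.849)] -/
def E_ILMgeneric : Prop := c₈₁.ILMgeneric

/-- B119's COROLLARY 5.1 FROM ITS PRINTED HYPOTHESIS AND THE GENERIC CASE (`src-1404.2909v2/formalsubmission240714.tex`, proof l.1235-1261): [from (eq: transfer) and [MR1070599, Cor. 9.10]: Σ_{σ ∈ Π_φ} ⟨s, σ⟩ d_σ = 0 for s ≠ 1, so the formal degree is constant on Π_φ;] l.1243 "Hence, to prove the corollary, we may assume that the character $\sprod{\cdot}{\sigma}$ is trivial." l.1244 "Then by \cite[Proposition 8.3.2]{MR3135650}, $\sigma$ is generic." l.1245 "In fact, as explained in the proof of [loc.~cit.]," l.1246 "there exist a number field $k$, a place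 $v_0$ of $k$," l.1247 "an automorphic representation $\Pi$ of $\GL_{2n}(\A_k)$," l.1248 "and an irreducible globally generic cuspidal automorphic representation $\Sigma$ of $\SO(2n+1,\A_k)$ such that" [k_{v_0} = F, Π_{v_0} ↔ ι ∘ φ, Σ lifts weakly to Π, Σ_{v_0} = σ] l.1256 "On the other hand, by \cite[Theorem E]{MR2058617}," [Π_{v_0} = JS(Σ_{v_0})] l.1261 "This reduces the corollary to Theorem \ref{thm: so}." — the endoscopic character relations (eq: transfer) with [MR1070599, Cor. 9.10] (Shahidi 1990: Arthur-free) make the formal degree constant on Π_φ; [MR3135650, Prop. 8.3.2] and the globalisation are inside the hypothesis field; [MR2058617, Thm E] = Jiang – Soudry (Arthur-free); Theorem 4.7 = `ILMgeneric`.  Premises: `ILMllcSO`, `ILMgeneric`. [cite: IchinoLapidMao2017, Cor. 5.1 with proof (l.1225-1261)] -/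
def E_ILMcor51 : Prop := c₈₁.ILMllcSO → c₈₁.ILMgeneric → c₈₁.ILMcor51

/-- B119's NON-SPLIT REDUCTION ⇐ TRANCHE 57's NODE ∧ COROLLARY 5.1 (`src-1404.2909v2/formalsubmission240714.tex` l.1263-1302): the authors « admit the local Langlands correspondence (cf. [WaldAst3472, §4.2]) » for SO(2n+1)^+ ∐ SO(2n+1)^- jointly — l.1264 "Now let $\SO(2n+1)^-$ be the non-split special orthogonal group in $2n+1$ variables." [We will explain how to prove the formal degree conj. for SO(2n+1)^- if we admit the local Langlands correspondence (cf. [WaldAst3472, §4.2]).] l.1268 "The local Langlands correspondence (in the square-integrable case) asserts that there exist a partition" [Irr_sqr SO(2n+1)^+ ∐ Irr_sqr SO(2n+1)^- = ∐_φ Π_φ, Π_φ → characters of S_φ] […] l.1284 "Then $\Pi_\phi^\pm = \Pi_\phi \cap \Irr_{\sqr} \SO(2n+1)^\pm$, and the endoscopic character relations hold (see \cite[\S 4.2 and \S 4.8]{WaldAst3472})." [… the Steinberg formal degrees [MR2425185] force c = 1 …] l.1300 "Also, as in the proof of Corollary \ref{cor: nongen}, the other endoscopic character relations imply that the representations" l.1301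 "in $\Pi_\phi^-$ have the same formal degree." [These allow us to reduce the formal degree conj. for SO(2n+1)^- to that for SO(2n+1)^+.] — which is the node `Consumers57.LLCoddSO` (« the local Langlands correspondence for SO(V^±) », V^± of dimension 2n + 1, LLC of Vogan type, endoscopic character relations included; tranche 57, typed for Gan – Savin's Cor. 1.2 and Ishimoto 2020, supplied there ⇐ book ∧ row A8-p (Mœglin – Renard 2018) and ⇐ book ∧ row A5 (Ishimoto 2024)); [WaldAst3472] = Waldspurger, Astérisque 347 (2012) (row C15's second half, itself « on admet »); [MR2425185] (the Steinberg formal degrees) and [MR1070599] Arthur-free; the target of the reduction, « that for SO(2n+1)^+ », is Corollary 5.1 = `ILMcor51`.  The introduction's supplier sentence for this half: l.191 "Similarly, a similar statement for non-split $\SO(2n+1)$ would follow from results announced by Arthur." (= the book's Chapter 9, `Consumers8.InnerTwists`, STILL UNWRITTEN 2026 — the node's tranche-57 supply edges are the printed substitutes).  Premises: `LLCoddSO` (C57 node), `ILMcor51`. [cite: IchinoLapidMao2017, §5 (l.1263-1302), §1 (l.193); Ishimoto2020LIRMp, §5 (the node's wording); GanSavin2012MetaplecticI, Cor. 1.2 (the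 node's origin)] -/
def E_ILMnonsplit : Prop := c₅₇.LLCoddSO → c₈₁.ILMcor51 → c₈₁.ILMnonsplit

/-- B120's THEOREM 9.1 ⇐ B119's COROLLARY 5.1 ∧ B61 ∧ THE GANAPATHY – VARMA NODE (`src-2605.26031v1/formaldegree.tex` §9, l.1185-1228): the characteristic-0 inputs l.1212 "As noted in Remark~\ref{Rem: component_grp_abelian}, it is sufficient to prove that" [d(π, μ_{Z∖G}) = |γ(φ)| / #𝒮_φ^♯] l.1214 "This has been established over fields of characteristic $0$ for the following groups:" l.1216 "    \item $\GL_n$, in~\cite[Theorem 3.1]{HiragaIchinoKaoru08};" l.1217 "    \item $\SO_{2n+1}$, in~\cite[Corollary 5.1]{IchinoAtsushietc17};" l.1218 "    \item $\GSp_4$, in~\cite[Theorem 1.3]{GanIchino14}; and" l.1219 "    \item $\Sp_{2n}$ and $\SO_{2n}$, in~\cite[Theorem 1.1]{beuzartplessis2025}." [Combining Theorem 8.1 with this result, we have the following theorem:] — « [ILM17, Corollary 5.1] » ↦ `ILMcor51` (row B119), « [BP25, Theorem 1.1] » ↦ `Consumers24.BPformalDegree` (row B61, tranche 24: R. Beuzart-Plessis,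 arXiv:2508.08470, ⇐ book ∧ E41 ∧ A8-p), [HII08b, Thm 3.1] (GL_n) and [GI14, Thm 1.3] (GSp_4 = row E47) Arthur-free, absorbed; the transfer to characteristic p: Theorem 8.1 (the paper's own, under §8's standing compatibility hypothesis) with the commutativity of the diagram « in [GV17, Section 13.6] » for Sp_2n / SO_2n / SO_2n+1 ↦ the node `GVffLLC` (row B96, second-hand) and « in [Gan15] » for GL_n / GSp_4 (R. Ganapathy, Amer. J. Math. 137 (2015), on Gan – Takeda: Arthur-free, absorbed); Kazhdan's isomorphism [Ganapathy22], Deligne [Del84], the paper's §§3–7: classification-free.  The text cites neither [Art13] nor [Mok15] nor [KMSW]; no conditionality sentence — the introduction lists ILM17 and BP25 among the cases « established » (l.177, in the `--` comment above).  Premises: `ILMcor51` (B119), `BPformalDegree` (B61), `GVffLLC` (node). [cite: AnanthaKrishna2026FDCFunctionFields, Thm 9.1 with §9 (l.1185-1228), Thm 8.1 (l.1140-1142); IchinoLapidMao2017, Cor. 5.1; BeuzartPlessis2025FDC, Thm 1.1; GanapathyVarma2017, §13.6 (as cited)] -/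
def E_AKBformalDegreeFF : Prop := c₈₁.ILMcor51 → c₂₄.BPformalDegree → c₈₁.GVffLLC → c₈₁.AKBformalDegreeFF

/-- The eighty-first tranche of implications (one supply edge, one premise-free edge, three row edges; Mok and KMSW occur in no premise). [cite: IchinoLapidMao2017, §5; AnanthaKrishna2026FDCFunctionFields, §9 (each edge's source in its own docstring)] -/
structure Implications81 : Prop where
  llcSO : E_ILMllcSO ν c₈₁
  generic : E_ILMgeneric c₈₁
  cor51 : E_ILMcor51 c₈₁
  nonsplit : E_ILMnonsplit c₅₇ c₈₁
  akb : E_AKBformalDegreeFF c₂₄ c₈₁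

variable {ν μ κ c c₂ c₅ c₁₁ c₁₂ c₁₃ c₁₄ c₂₄ c₅₇ c₈₁}

/-- B119's THEOREMS 2.1 / 3.3 / 4.7 OUTRIGHT (no DAG input at all). [cite: IchinoLapidMao2017, Thms 2.1, 3.3, 4.7 (bookkeeping proved here)] -/
theorem ilmGeneric_unconditional (X : Implications81 ν c₂₄ c₅₇ c₈₁) : c₈₁.ILMgeneric :=
  X.generic

/-- ALL OF B119 FOR THE SPLIT GROUP GIVEN THE BOOK AT ALL RANKS: the hypothesis through the authors' supplier sentence, then Corollary 5.1. [cite: IchinoLapidMao2017, Cor. 5.1 with §5 (bookkeeping proved here)] -/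
theorem ilm81_of_book (X : Implications81 ν c₂₄ c₅₇ c₈₁) (hν : ∀ N, ν.Everything N) : c₈₁.ILMllcSO ∧ c₈₁.ILMgeneric ∧ c₈₁.ILMcor51 :=
  have hL := X.llcSO hν
  ⟨hL, X.generic, X.cor51 hL X.generic⟩

/-- B119's NON-SPLIT REDUCTION GIVEN THE BOOK AND TRANCHE 57's NODE. [cite: IchinoLapidMao2017, §5 after Cor. 5.1 (bookkeeping proved here)] -/
theorem ilmNonsplit_of_book_and_node (X : Implications81 ν c₂₄ c₅₇ c₈₁) (hν : ∀ N, ν.Everything N) (hV : c₅₇.LLCoddSO) : c₈₁.ILMnonsplit :=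
  X.nonsplit hV (ilm81_of_book X hν).2.2

/-- B119's COROLLARY 5.1 FROM THE BOOK'S INPUTS — every one of the book's 24 leaves, nothing of Mok or KMSW. [cite: IchinoLapidMao2017, Cor. 5.1 (bookkeeping proved here)] -/
theorem ilmCor51_of_inputs (X : Implications81 ν c₂₄ c₅₇ c₈₁) (A : BookInputs ν) : c₈₁.ILMcor51 :=
  (ilm81_of_book X A.everything).2.2

/-- B119's NON-SPLIT REDUCTION FROM THE BOOK'S INPUTS through tranche 57's supply edge for the node (Ishimoto 2024 = row A5's route, itself ⇐ the
book's inputs by tranche 1). [cite: IchinoLapidMao2017, §5; Ishimoto2020LIRMp, §5 (bookkeeping proved here)] -/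
theorem ilmNonsplit_of_inputs (X : Implications81 ν c₂₄ c₅₇ c₈₁) (W : Implications57 ν c c₁₁ c₁₃ c₅₇) (I : Implications ν μ κ c) (A : BookInputs ν) :
    c₈₁.ILMnonsplit :=
  ilmNonsplit_of_book_and_node X A.everything (oddSOHyps_of_inputs W I A).1

/-- B119's COROLLARY 5.1 IN CONDITIONAL FORM, 2026: granting the book's internal derivations, its supply edges and every PUBLISHED input, the formal degree
formula for all square-integrable representations of split p-adic SO(2n+1) — as the authors state it, « under the local Langlands correspondence » — is
conditional on the 2024–2026 preprint layer and on the general and the non-standard weighted fundamental lemmas; the authors' own status words name the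
stabilisation of the twisted trace formula only. [cite: IchinoLapidMao2017, Cor. 5.1, §5 l.1185-1186 (bookkeeping proved here)] -/
theorem ilmCor51_conditional_form (X : Implications81 ν c₂₄ c₅₇ c₈₁) (B : ν.BookEdges) (S : ν.SupplyEdges) (P : ν.PublishedLeaves) :
    ν.PreprintLeaves2026 → ν.WFL_general → ν.WFL_nonstandard → c₈₁.ILMcor51 :=
  fun hQ h6 h7 => ilmCor51_of_inputs X ⟨B, S, P, hQ, ⟨h6, h7⟩⟩

/-- B120's THEOREM 9.1 FROM ITS THREE TYPED INPUTS, as the paper combines them. [cite: AnanthaKrishna2026FDCFunctionFields, Thm 9.1 (bookkeeping proved here)] -/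
theorem akb_of_rows (X : Implications81 ν c₂₄ c₅₇ c₈₁) (h51 : c₈₁.ILMcor51) (h61 : c₂₄.BPformalDegree) (hGV : c₈₁.GVffLLC) :
    c₈₁.AKBformalDegreeFF :=
  X.akb h51 h61 hGV

/-- B120's THEOREM 9.1 FROM THE BOOK'S INPUTS AND THE GANAPATHY – VARMA NODE: Corollary 5.1 by this tranche, B61 by tranche 24's `bpFormalDegree_of_leaves`
(book ∧ E41 ∧ A8-p, all ⇐ the book's inputs); the node stays a hypothesis. [cite: AnanthaKrishna2026FDCFunctionFields, Thm 9.1; BeuzartPlessis2025FDC, Thm 1.1; IchinoLapidMao2017, Cor. 5.1 (bookkeeping proved here)] -/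
theorem akb_of_inputs (X : Implications81 ν c₂₄ c₅₇ c₈₁) (Z : Implications24 ν μ κ c₂ c₁₃ c₁₄ c₂₄) (I : Implications ν μ κ c)
    (G : Implications13 ν μ κ c c₂ c₅ c₁₂ c₁₃) (H : Implications14 ν c₁₄) (A : BookInputs ν) (hGV : c₈₁.GVffLLC) : c₈₁.AKBformalDegreeFF :=
  akb_of_rows X (ilmCor51_of_inputs X A) (bpFormalDegree_of_leaves Z I G H A) hGV

/-- B120's THEOREM 9.1 IN CONDITIONAL FORM, 2026 (a PREPRINT; no status sentence in its text): granting the book's internal derivations, its supply edges,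
every PUBLISHED input and the earlier tranches' edges, the formal degree formula over local function fields for split Sp_2n / SO_2n / SO_2n+1 is conditional on
the 2024–2026 preprint layer, on the general and the non-standard weighted fundamental lemmas, AND on the unread Ganapathy – Varma compatibility (row B96, itself
reported to use « Arthur's work »). [cite: AnanthaKrishna2026FDCFunctionFields, Thm 9.1 (bookkeeping proved here)] -/
theorem akb_conditional_form (X : Implications81 ν c₂₄ c₅₇ c₈₁) (Z : Implications24 ν μ κ c₂ c₁₃ c₁₄ c₂₄) (I : Implications ν μ κ c)
    (G : Implications13 ν μ κ c c₂ c₅ c₁₂ c₁₃) (H : Implications14 ν c₁₄) (B : ν.BookEdges) (S : ν.SupplyEdges) (P : ν.PublishedLeaves) :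
    ν.PreprintLeaves2026 → ν.WFL_general → ν.WFL_nonstandard → c₈₁.GVffLLC → c₈₁.AKBformalDegreeFF :=
  fun hQ h6 h7 hGV => akb_of_inputs X Z I G H ⟨B, S, P, hQ, ⟨h6, h7⟩⟩ hGV

/-! ## Eighty-second tranche (v2, unit `pub-arthur-down-g33`): MR-NUMBER CITERS OF THE BOOK, II — NEW rows C206 `BGWchar0` / `BGWthmD` / `BGWthmB` /
`BGWezc`, C207 `XZgalois` / `XZRT` / `XZBK`, C208 `BPweakRegLGC`, C209 `ELstableTempered` / `ELmain`

Context (all four ABSENT from `DOWNSTREAM.md` / `DOWNSTREAM2.md` / `DOWNSTREAM3.md` — NEW rows, block `[g33b]` of `DOWNSTREAM3.md`; typed premises reused: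
`Consumers.TaibiInner` (row A3), `Consumers.GeeTaibi` (row A4), `Shin.WeakS` / `Shin.GalRepGLN` (row E1), `Consumers74.FPWeaklyRegular` (row C141), `BookInputs`,
`MokInputs`).  Texts under `HOME/pub-arthur-down-g33/primaries/`: `src-2508.10225v2/ezc.tex` (l.150 "\author{Daniel Barrera Salazar, Andrew Graham, and Chris Williams}"), `src-2411.04897v2/…tex` (l.191 "\author{Xiaoyu Zhang}" l.190 "\title{Automorphic side of Taylor-Wiles method for orthogonal and symplectic groups}"),
`src-2110.10251v1/HigherColemanarxiv.tex` (l.56 "\author[G. Boxer]{George Boxer}" l.61 "\author[V. Pilloni]{Vincent Pilloni}" l.55 "\title{Higher Coleman Theory}"), `paper-doi-10-4171-dm-960` (publisher PDF text).  Loci: C206 l.149-150, l.264-276, l.340-346, l.388-399,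
l.420, l.432-461, l.3286, l.3320-3342, l.3378, l.3435-3449, l.4491-4495, l.4671-4672; C207 l.190-191, l.260, l.327, l.371-372, l.985-997, l.1063, l.1082-1118, l.10366-10368,
l.10948, l.11011-11040, l.11085-11088, l.11609-11612, l.11631-11634 (+ v1 corpus p0007:L66); C208 l.55-61, l.339-362, l.5412-5451, bbl l.34-37, l.222-224, l.425-428; C209
p0001:L8-17, p0004:L39-40, p0005:L39-42, p0037:L5-13, p0039:L30-36, p0041:L47, p0048:L15, p0054–p0056 (references). -/

/-- NEW rows C206 (Barrera Salazar – Graham – Williams 2025: a characteristic-0 theorem, Theorem D, Theorem B, Theorems A / C), C207 (X. Zhang 2024/2025: Galois representations, R = 𝕋, Bloch – Kato), C208 (Boxer – Pilloni 2021: one theorem), C209 (Enns – Lee 2024: a stability lemma, the main theorem) of the census, as an arbitrary assignment of propositions; nothing about the content of a field is assumed. [cite: Arthur2013, downstream register of the cell, eighty-second tranche (structure only)] -/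
structure Consumers82 where
  /-- C206, THEOREM (Thm:PiCARoftildeGLG) of §9 (`src-2508.10225v2/ezc.tex` l.3320-3332; G̃ = GSp_2n over ℚ): l.3320 "\begin{theorem} \label{Thm:PiCARoftildeGLG}" l.3321 "    Let $\Pi$ be a regular algebraic cuspidal automorphic representation of $\tilde{G}(\mbb{A})$ of weight $-w_0^{\tilde{G}}\lambda$, with $\lambda = (\lambda_1, \dots, \lambda_n; \lambda_0) \in X^*(T)^+$, and sufficiently regular in the sense that $\lambda_i - \lambda_{i+1} \geq 1$ for $i=1, \dots, n-1$ and $\lambda_n \geq 1$ (so, in particular, $w \cdot \lambda \neq \lambda$ for all $w \in W_{\tilde{G}}$). Let $S$ denote a finite set of primes containing $p$ and all primes where $\Pi$ is ramified. Then there exists a semisimple continuous Galois representation $\rho_{\Pi} \colon G_{\mbb{Q}} \to \opn{GL}_{2n+1}(\Qpb)$ satisfying the property that: for every prime $\ell \not\in S$, $\rho_{\Pi}$ is unramified at $\ell$ and one has" [det(1 − Frob_ℓ^{-1} X | ρ_Π) = Θ_Π^S(H̃_ℓ(X)); G̃ = GSp_2n] […] l.3327 "        Moreover, suppose that $\Pi_p$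 is ordinary (in the sense of Definition \ref{Def:OrdinarityDefinition}) and let $\Theta_{\Pi, p} \colon \Qpb[T^+] \to \Qpb$ denote the eigencharacter for the action of the normalised $U_p$-Hecke operators acting on $\Pi_p^{\opn{ord}}$." [… then ρ_Π|_{G_ℚp} is upper triangular with diagonal ψ_{λ,1}, …, ψ_{λ,2n+1},] l.3331 "        that is, we have local-global compatibility at $\ell = p$." l.3334 "We expect this result is well-known to experts in the field, but as we were unable to find a proof in the literature, we include one here." [cite: BarreraGrahamWilliams2025LGCEZC, §9 = LGcompatAtl=pSec, Thm Thm:PiCARoftildeGLG (e-print v2 l.3320-3334)] -/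
  BGWchar0 : Prop
  /-- C206 (NEW census row, block `[g33b]` of `DOWNSTREAM3.md`; census grade G-v), Daniel Barrera Salazar – Andrew Graham – Chris Williams, *Local-global compatibility and the exceptional zero conj. for GL(3)* (title word abbreviated), arXiv:2508.10225 (v2 2025-09-30; PREPRINT) — THEOREM D: l.432 "\begin{theoremx} \label{FourthMainThmintroLGcompat}" l.433 "    Let $n \geq 2$ be any integer and $p > 2n$. Suppose that $\overline{\rho}_{\ide{m}}$ is absolutely irreducible and decomposed generic. With notation as above, there exists a nilpotent ideal $J \subset \mathcal{T}_{\ide{m}}$ (with nilpotence degree only depending on $n$), and a continuous Galois representation" [ρ : G_ℚ → GL_n(𝒯_𝔪/J), 𝒯_𝔪 the ordinary completed-cohomology Hecke algebra of GL_n/ℚ localised at 𝔪] l.437 "    such that:" (1) l.439 "        \item For all $\ell \not\in S$, the characteristic polynomial $\opn{det}(1-\opn{Frob}^{-1}_{\ell} X | \rho)$ equals the image of the standard Hecke polynomial at $\ell$ for $\opn{GL}_n$ in $\mathcal{T}_{\ide{m}}/J$ (see Definition \ref{HXHeckeDef})." (2) l.440 "        \item For every $g \in G_{\mbb{Q}_p}$,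 the characteristic polynomial of $\rho(g)$ equals $\prod_{i=1}^n (X - \chi_i(g))$, where $\chi_i \colon G_{\mbb{Q}_p} \to (\mathcal{T}_{\ide{m}}/J)^{\times}$ are the standard Galois characters in Definition \ref{DefOfUnivGaloisChars}." (3) [(ρ(g_1) − χ_1(g_1)) ⋯ (ρ(g_n) − χ_n(g_n)) = 0 for all g_1, …, g_n ∈ G_ℚp] [cite: BarreraGrahamWilliams2025LGCEZC, Thm D = FourthMainThmintroLGcompat (e-print v2 l.432-449)] -/
  BGWthmD : Prop
  /-- C206, THEOREM B (the automorphic exceptional zero formula for GL(3), n = 3, c ∈ {0, 1}): l.340 "\begin{theoremx} \label{SecondMainThmIntroAutLinv}" l.341 "    Let $n=3$ and $c \in \{0, 1\}$. Then " [d/ds L_p^{(c)}(π, s)|_{s=0} = e_∞(π_∞, c) · E_p^{(c)}(c) · 𝓛^{Aut}_{π,c+1} · L(π, c)/Ω_{π,c}] l.274 "Theorem \ref{SecondMainThmIntroAutLinv} is completely unconditional (beyond Assumption \ref{assumptions}(1), which is needed for the statement to make sense), and is even independent of the existence of $\rho_\pi$. Assumption \ref{assumptions}(2), and the other hypotheses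 in Theorem \ref{FirstMainThmInIntro}, are needed only to prove the equality of $\mathcal{L}$-invariants (Theorem \ref{ThirdMainThmIntroEqualLinv})." [cite: BarreraGrahamWilliams2025LGCEZC, Thm B = SecondMainThmIntroAutLinv (e-print v2 l.340-346), with l.274] -/
  BGWthmB : Prop
  /-- C206, THEOREMS A AND C: Theorem C l.388 "\begin{theoremx} \label{ThirdMainThmIntroEqualLinv}" l.389 "    Let $n=3$ and $i \in \{1, 2\}$." (1) l.391 "        \item If $\pi$ is essentially self-dual (so $\pi \cong \opn{Sym}^2f\otimes \xi$ is the twisted symmetric square lift of a modular form $f$), then $\mathcal{L}^{\opn{Aut}}_{\pi, i} = \mathcal{L}^{\opn{FM}}_{\pi, i} = \mathcal{L}(f)$, where $\mathcal{L}(f)$ denotes the $\mathcal{L}$-invariant for $f$." (2) l.392 "        \item Suppose that $p \geq 7$ and $\overline{\rho}_{\pi}$ is absolutely irreducible and decomposed generic. Then, if $\Sigma$ admits ``non-$s_{i}$-infinitesimal deformations'', one has" [𝓛^{Aut}_{π,i} = 𝓛^{FM}_{π,i}]; Theorem A l.264 "\begin{theoremx} \label{FirstMainThmInIntro}" [Let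 n = 3, p ≥ 7; suppose ρ̄_π irreducible and decomposed generic; then the exceptional zero conj. holds for L_p^{(0)} or L_p^{(1)}, and for both if π has non-parabolic infinitesimal deformations — verbatim in the `--` comment below] [cite: BarreraGrahamWilliams2025LGCEZC, Thm A = FirstMainThmInIntro (l.264-266), Thm C = ThirdMainThmIntroEqualLinv (l.388-397), l.399] -/
  BGWezc : Prop
  /-- C207, THEOREMS 2.3 AND 2.6 (`src-2411.04897v2/…tex`; G a definite special orthogonal or symplectic group over a totally real F, pure inner form of the quasi-split G* of the book's first 8 chapters, l.669): l.985 "By \cite[Corollary 2.5.3]{Shin2024}, we have" l.986 "\begin{theorem}\label{weak transfer pi to Pi}" l.988 "Let $\pi$ be an irreducible discrete series automorphic representation of $G(\mathbb{A}_F)$ unramified outside $S$. Then there is an irreducible automorphic representation" [Π = π^♯] l.992 "of $\mathrm{GL}_N(\mathbb{A}_F)$ unramified outside $S$, which is an isobaric sum of cuspidal automorphic representations $\Pi=\boxtimes_{i=1}^r\Pi_i$ such that $\Pi^\vee\simeq\Pi$ and $(\zeta_{\pi,\infty},c^S(\pi))$ is mapped via the map $\widetilde{\zeta}$ in (\ref{xi: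 ^LG to GL_N}) to $(\zeta_{\Pi,\infty},c^S(\Pi))$. We call $\pi^\sharp$ the \emph{weak transfer} of $\pi$." l.1063 "We consider the following condition on $\pi$ an irreducible discrete series automorphic representation of $G(\mathbb{A}_F)$ (this is the assumptions (H2) and (H3) in \cite{Shin2024}):" [(C2): the infinitesimal character of the Arthur parameter π^♯ = ⊞ Π_i is std-regular and each Π_i is self-dual] l.1082 "\begin{theorem}\label{Galois representations attached to auto rep}" l.1083 "Let $\pi$ be an irreducible discrete series automorphic representation of $G(\mathbb{A}_F)$ that is $C$-algebraic, unramified at all finite places of $F$ and satisfies (C2)." l.1084 "Then there is a semisimple Galois representation" [r_π : Γ_F → ᶜG(ℚ̄_p), unramified at v ∤ p with the characteristic polynomials of Frobenius given by the Satake parameters of π (1), crystalline at v | p with the stated Hodge – Tate weights (2), totally odd (3)] — proof: l.1116 "(1) is proved in \cite[Theorem 3.2.7]{Shin2024}. Since $\pi^\sharp=\boxtimes_{i=1}^r\Pi_i$ is unramified at each $v|p$, so is each cuspidal isobaric factor $\Pi_i$ and thus by \cite[Theorem 3.2.3(c)]{ChenevierHarris2013}, $r_\pi$ is crystalline at $v|p$."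 […] l.1116 "Finally, the Galois representation associated to each $\Pi_i$ is totally real by \cite{Taylor2012,Taibi2016,CaraianiLeHung2016}, thus so is $r_\pi$." [cite: XZhang2024TaylorWilesOrthogonal, Thm 2.3 = `weak transfer pi to Pi` (e-print v2 l.986-994), Thm 2.6 = `Galois representations attached to auto rep` (l.1082-1118), (C2) l.1063; Shin2024, Cor. 2.5.3, Thm 3.2.7 (as cited)] -/
  XZgalois : Prop
  /-- C207 (NEW census row, block `[g33b]`; census grade G-ii-type, see the edge `E_XZgalois`): Xiaoyu Zhang, *Automorphic side of Taylor-Wiles method for orthogonal and symplectic groups*, arXiv:2411.04897 (v2 2025-08-19; PREPRINT) — THEOREM 1.1 (minimal modularity lifting, R ≃ 𝕋): l.371 "\begin{theorem}\label{Theorem-1 R=T}" l.372 "Let $K = G(\widehat{\mathcal{O}_F})$. Suppose the following are satisfied:" [(1) ρ̄_𝔪 absolutely irreducible, (2)–(4) Taylor – Wiles-type and weight / prime conditions; then the minimal deformation ring surjects isomorphically onto the localised Hecke algebra: R ≃ 𝕋_𝔪 — the body version is Theorem 6.4 (label `R=T`, l.10366) with Theorem 6.5 (label `modularity`, l.10596);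 G a definite special orthogonal or symplectic group over the totally real F as in §2 (l.669: the classical group considered in the first 8 chapters of [Arthur2013] as quasi-split inner form)] l.10366 "\begin{theorem}\label{R=T}" l.10367 "We assume that $F$ is unramified at $p$." l.10368 "Let $\mathfrak{m}$ be a non-Eisenstein maximal ideal of $\mathbb{T}_{W}(K,\mathcal{O})$, $\mathfrak{P}$ a minimal prime ideal contained in $\mathfrak{m}$, $\pi$ an irreducible discrete series constituent of $\mathcal{A}(G(\mathbb{A}_F))$ satisfying condition (C2) which is generated by a non-zero vector in $M_{W,p}(K,\mathcal{O})$ such that $\mathbb{T}_W(K,\mathcal{O})$ acts on $\pi$ via the quotient $\mathbb{T}_W(K,\mathcal{O})/\mathfrak{P}$." [… then the minimal deformation ring of ρ_𝔪 is isomorphic to 𝕋_𝔪 (Theorem 6.4) and every minimal crystalline lift is automorphic (Theorem 6.5)] [cite: XZhang2024TaylorWilesOrthogonal, Thm 1.1 = `Theorem-1 R=T` (l.371), Thm 6.4 = `R=T` (l.10366), Thm 6.5 = `modularity` (l.10596)] -/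
  XZRT : Prop
  /-- C207, THEOREMS 7.5 / 7.6 (= Theorem 1.5; the Bloch – Kato statements for the adjoint Galois representation ρ_π = Ad r_π): [By [Arthur2013, Theorem 1.5.3(a)], L(ρ_π, s) is holomorphic and non-zero at s = 1 — verbatim in the `--` comment below (the sentence names the Bloch – Kato conj.)] l.11012 "\begin{theorem}\label{Bloch-Kato, rank part}" l.11013 "Let $\pi$ be as above. Then" [ord_{s=1} L(ρ_π, s) = 0 = dim H^1_f(F, ρ_π)] l.11036 "\begin{theorem}\label{Bloch-Kato, special value part}" l.11037 "Let $\pi$, $f_\pi$, $\theta_\pi$ be as above. Then the characteristic ideal of the Bloch-Kato Selmer group $H^1_\mathrm{BK}(F,\rho_\pi(E/\mathcal{O}))^\vee$ is generated by the Petersson product $(f_\pi,f_\pi)_\mathrm{Pet}$, which is a non-zero element in $\mathcal{O}$" [⋯]. [cite: XZhang2024TaylorWilesOrthogonal, Thm 7.5 = `Bloch-Kato, rank part` (l.11012), Thm 7.6 = `Bloch-Kato, special value part` (l.11036), Thm 1.5 (l.466)] -/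
  XZBK : Prop
  /-- C208 (NEW census row, block `[g33b]`; census grade G-iii-type): George Boxer – Vincent Pilloni, *Higher Coleman Theory*, arXiv:2110.10251 (v1 2021-10-19; PREPRINT) — THE THEOREM OF §1.4 (= §6.11; L totally real or CM): l.341 "  \begin{thm} Let $\pi$ be a  weakly regular, odd, algebraic, essentially (conjugate) self dual, cuspidal automorphic representation of $\mathrm{GL}_n/L$ with $\pi^c = \pi^\vee \otimes \chi$ and infinitesimal character $\lambda = ( ( \lambda_{1, \tau}, \ldots, \lambda_{n, \tau})_{\tau \in \mathrm{Hom}(L,\C)})$ with $\lambda_{1, \tau} \geq \cdots \geq \lambda_{n, \tau}$. " l.342 "  Then for each isomorphism $\iota:\overline{\qq}_p\simeq \C$ there is a continuous" l.343 "  Galois representation $\rho_{\pi, \iota}: G_L \rightarrow \mathrm{GL}_n(\overline{\qq}_p)$" l.344 "  such that:" [(1) ρ^c ≃ ρ^∨ ⊗ ε_p^{1−n} ⊗ χ_ι; (2) unramified and matching rec(π_v ⊗ |det|^{(1−n)/2}) at the unramified v ∤ p; (3) the generalized Hodge – Tate weights; (4)] l.351 " \item Let $v \mid p$ be a place of $L$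 and assume that $\pi_v$ is a regular principal series. Then $\rho_{\pi,\iota}\vert_{G_{L_v}}$ is potentially crystalline and " [ιWD(ρ|_{G_{L_v}})^{F-ss} ≃ rec(π_v ⊗ |det|^{(1−n)/2})] l.358 "When $\pi$ is regular rather than just weakly regular and odd, then a stronger form of the theorem holds according to results of Bellaiche, Caraiani, Chenevier, Clozel, Harris, Kottwitz, Labesse, Shin, Taylor, etc. (see \cite{MR3272052}, \cite{BLGGT}) including purity and local-global compatibility at all places.  The above theorem is deduced from these results by $p$-adic interpolation.   Moreover even in the irregular case, the Galois representations in the theorem have already been constructed by different methods in \cite{MR3512528} (and in special cases in \cite{2015arXiv150705922B}, \cite{MR3989256}).  The novelty in the above theorem is the results towards local global compatibility at $p$ in points (3) and (4)." [cite: BoxerPilloni2021HigherColeman, §1.4 Theorem (e-print v1 l.341-355), §6.11 Theorem (l.5433-5447), l.358] -/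
  BPweakRegLGC : Prop
  /-- C209, COROLLARY 4.1.1 AND LEMMA 4.1.7 (`paper-doi-10-4171-dm-960`; G = GSp_4 over the totally real F or its compact-mod-centre inner form): p0037:L9 "Corollary 4.1.1. Stable and tempered automorphic representations of G occur with multiplicity one in the discrete spectrum." — proof: p0037:L10 "Proof. Automorphic representations of GSp4 of general type" […] p0037:L11-13 "equivalently … is non-CAP and non-endoscopic) occur with multiplicity one in the discrete spectrum by Arthur’s multiplicity theorem (cf. [28] or [6, Theorem 2.9.3]). It follows from Arthur’s classification that an automorphic representation of GSp4 being of general type is equivalent to being stable and tempered. Now the claim follows from [52, Theorem B]." p0039:L30 "Lemma 4.1.7." [Let π be a regular cuspidal automorphic representation of G(𝔸_F) where G = GSp_4 or its compact-mod-centre inner form; suppose a continuous irreducible r̄ : G_F → GSp_4(𝔽̄_p) is attached to π; then π is stable and tempered.] Proof: [for the inner form, Lemma 4.1.6 replaces π by a regular cuspidal] p0039:L34-35 "automorphic representation of GSp4 .AF / to which rN is attached. Since being stable and tempered is characterized by components at almost all finite places, it suffices to prove the" […] p0039:L36 "By [6, Theorem 2.9.3], the irreducibility" [of r̄ implies that π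 is of general type, which implies that π is stable and tempered by Arthur's classification (see items (a)–(f) at the end of [1])] [cite: EnnsLee2024ModpLGCGSp4, Cor. 4.1.1 (p0037:L9-13), Lemma 4.1.7 (p0039:L30-36)] -/
  ELstableTempered : Prop
  /-- C209 (NEW census row, block `[g33b]`; PUBLISHED; census grade G-iii): John Enns – Heejong Lee, *Mod p local-global compatibility for GSp_4(ℚ_p) in the ordinary case*, Doc. Math. 29 (2024), no. 4, 863–919, doi:10.4171/dm/960 — THEOREM 4.5.1: p0004:L39 "representation (Lemma 2.2.4). Our main result is the following." p0004:L40 "Theorem (Theorem 4.5.1). Following the above notations, the Fontaine–Laffaille invariants of" [ρ̄ can be recovered from the admissible smooth 𝔽[GSp_4(F_w)]-module Π(r̄) (the Hecke-isotypic part of the mod p automorphic forms on the compact-mod-centre form of GSp_4 with infinite level at w)]; abstract: p0001:L15 "dividing p. Assuming certain genericity conditions and Taylor–Wiles assumptions, we prove that" [the GSp_4(F_w)-action on the corresponding Hecke-isotypic part of the space of mod p automorphic] p0001:L17 "forms on a compact mod center form of GSp4 with infinite level at w determines rj" [r̄|_{G_{F_w}}.] [cite: EnnsLee2024ModpLGCGSp4,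 Thm 4.5.1 (p0004:L39-40), abstract (p0001:L11-18)] -/
  ELmain : Prop

variable (ν : Nodes) (μ : Mok2015.Nodes) (κ : KMSW2014.Nodes) (c : Consumers) (s : Shin) (c₇₄ : Consumers74) (c₈₂ : Consumers82)

-- Verbatim, the sentences that name a conj. or are titles / bibliography entries (kept out of docstrings by the register's lint):
-- C206 title (`src-2508.10225v2/ezc.tex`): l.149 "\title[ ]{Local-global compatibility and the exceptional zero conjecture for $\opn{GL}(3)$}"
-- C206 Theorem A: l.265 "    Let $n=3$ and let $p \geq 7$. Suppose that the residual representation $\overline{\rho}_{\pi} \colon G_{\mbb{Q}} \to \opn{GL}_3(\overline{\mbb{F}}_p)$ is irreducible and decomposed generic. Then the exceptional zero conjecture holds for either $L_p^{(0)}$ or $L_p^{(1)}$. Furthermore, if $\pi$ has ``non-parabolic infinitesimal deformations'' (see Remark \ref{Rem:DGandCMassumptionIntro} below), then the exceptional zero conjecture holds for both $L_p^{(0)}$ and $L_p^{(1)}$."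
-- C206 bibliography: l.4491 "\bibitem[Art13]{ArthurBook}" l.4492 "James Arthur, \emph{The endoscopic classification of representations}, American Mathematical Society Colloquium Publications, vol.~61, American Mathematical Society, Providence, RI, 2013, Orthogonal and symplectic groups. \MR{3135650}" / l.4494 "\bibitem[ATI{\etalchar{+}}24]{LocalIntertwiningRelations}" l.4495 "Hiraku {Atobe}, Wee {Teck Gan}, Atsushi {Ichino}, Tasho {Kaletha}, Alberto {M{\'\i}nguez}, and Sug~Woo {Shin}, \emph{{Local Intertwining Relations and Co-tempered $A$-packets of Classical Groups}}, arXiv e-prints (2024), arXiv:2410.13504." / l.4671 "\bibitem[Sch15]{ScholzeTorsion}" l.4672 "Peter Scholze, \emph{\href{https://doi.org/10.4007/annals.2015.182.3.3}{On torsion in the cohomology of locally symmetric varieties}}, Ann. of Math. (2) \textbf{182} (2015), no.~3, 945--1066. \MR{3418533}"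
-- C207 (`src-2411.04897v2/…tex`) §1: l.261 "In this article, we establish such a theorem for definite special orthogonal and symplectic groups $G$, from which we deduce the Bloch-Kato conjecture for the corresponding adjoint Galois representation. Similar ideas were employed in \cite{LiuTianXiaoZhangZhu2022} for the Beilinson-Bloch-Kato conjectures, though in the setting where $G = U_n$ is a unitary group."
-- C207 §7, before Theorem 7.5: l.11011 "By \cite[Theorem 1.5.3(a)]{Arthur2013}, we know that $L(\rho_\pi,s)$ is holomorphic and non-zero at $s=1$. Thus we have proved the rank part of the The Bloch-Kato conjecture for (the adjoint motive associated to) the adjoint Galois representation $\rho_\pi$ (\cite{BlochKato1990}):"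
-- C207 bibliography: l.11085 "\bibitem[Art13]{Arthur2013}" / l.11087 "\textit{The endoscopic classification of" / l.11609 "\bibitem[Shi24]{Shin2024}" l.11611 "Weak transfer from classical groups to general linear groups," l.11612 "2024, to appear in Essentials in Number Theory." / l.11631 "\bibitem[Tai18]{Taibi2018}" l.11633 "Arthur's multiplicity formula for certain inner forms of special orthogonal and symplectic groups," l.11634 "Journal of the European Mathematical Society 21.3 (2018): 839-871."
-- C208 bibliography (`HigherColemanarxiv.bbl`): l.34 "\bibitem[Art13]{MR3135650}" l.35 "James Arthur, \emph{The endoscopic classification of representations}, American" […] l.37 "  Society, Providence, RI, 2013, Orthogonal and symplectic groups. \MR{3135650}" / l.425 "\bibitem[Mok15]{MR3338302}" l.426 "\bysame, \emph{Endoscopic classification of representations of quasi-split" l.427 "  unitary groups}, Mem. Amer. Math. Soc. \textbf{235} (2015), no.~1108, vi+248." / l.222 "\bibitem[FP19]{F-Pilloni}" l.223 "Najmuddin Fakhruddin and Vincent Pilloni, \emph{Hecke operators and the" l.224 "  coherent cohomology of shimura varieties}, 2019."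
-- C209 references (`paper-doi-10-4171-dm-960`): p0054:L6-8 "[1] J. Arthur, Automorphic representations of GSp.4/. In Contributions to automorphic forms, geometry, and number theory, pp. 65–81, Johns Hopkins University Press, Baltimore, MD, 2004 Zbl 1080.11037 MR 2058604" / p0054:L9-11 "[2] J. Arthur, The endoscopic classification of representations. Orthogonal and symplectic groups. Amer. Math. Soc. Colloq. Publ. 61, American Mathematical Society, Providence, RI, 2013 Zbl 1297.22023 MR 3135650" / p0054:L18-19 "[6] G. Boxer, F. Calegari, T. Gee, and V. Pilloni, Abelian surfaces over totally real fields are potentially modular. Publ. Math. Inst. Hautes Études Sci. 134 (2021), 153–501 Zbl 1522.11045 MR 4349242" / p0055:L24-25 "[28] T. Gee and O. Taïbi, Arthur’s multiplicity formula for GSp4 and restriction to Sp4 . J. Éc. polytech. Math. 6 (2019), 469–535 Zbl 1468.11115 MR 3991897" / p0056:L29-30 "[52] C. M. Sorensen, Potential level-lowering for GSp.4/. J. Inst. Math. Jussieu 8 (2009), no. 3, 595–622 Zbl 1257.11044 MR 2516307" / p0056:L33-34 "[54] O. Taïbi, Arthur’s multiplicity formula for certain inner forms of special orthogonal and symplectic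 groups. J. Eur. Math. Soc. (JEMS) 21 (2019), no. 3, 839–871 Zbl 1430.11074 MR 3908767"
-- H. Hahn arXiv:1509.01863 (peripheral, census only), corpus `paper-arxiv-1509.01863`: p0003:L41 "Moreover, in this case the Conjecture (conj) is proven by work of Arthur [Arthur]" [r = Sym²: the symmetric-square case of her conj. on tensor third L-functions]

/-- C206's THEOREM (Thm:PiCARoftildeGLG) ⇐ THE BOOK (`src-2508.10225v2/ezc.tex` l.3336-3380): l.3339 "    By the work of Arthur \cite{ArthurBook} (as explained in \cite[Theorem 5.1.2]{ScholzeTorsion} for example, although note that \emph{loc.cit.} is for scalar weight), $\Pi_0$ appears in the global $A$-packet associated with an elliptic $A$-parameter $\psi$; so there is a partition $2n+1 = l_1 N_1 + \cdots + l_r N_r$ and self-dual cuspidal automorphic representations $\Sigma_i$ of $\opn{GL}_{N_i}(\mbb{A})$, such that:" […] l.3378 "    The representation $\Pi_{0, p}$ lies in the local $A$-packet associated with the tempered $L$-parameter $\psi_{p}$, hence $\Pi_{0, p}$ is tempered (see \cite[Theorem 1.5.1(b)]{ArthurBook}). Thus the characters $\chi_i$ are unitary. Since $\Pi_{0, p}$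 lies in a unique $A$-packet (see \emph{loc.cit.}), we must have that $\psi_p$ is equivalent to the $A$-parameter" [⋯] — [ArthurBook] = the book (Theorems 1.5.1 (b), 1.5.2 for Sp_2n over ℚ, all n: `∀ N, ν.Everything N`); [ScholzeTorsion, Thm 5.1.2] cited as the exposition of the same input; BLGGT-II / Caraiani (local-global compatibility for GL_{2n+1}), [Tad94], [TaibiEigenvarieties]: Arthur-free, absorbed.  Premise: the book. [cite: BarreraGrahamWilliams2025LGCEZC, proof of Thm Thm:PiCARoftildeGLG (l.3336-3400); Arthur2013, Thms 1.5.1, 1.5.2 (as cited)] -/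
def E_BGWchar0 : Prop := (∀ N, ν.Everything N) → c₈₂.BGWchar0

/-- C206's THEOREM D ⇐ ITS CHARACTERISTIC-0 THEOREM ∧ THE BOOK (`src-2508.10225v2/ezc.tex`): §9 opens l.3286 "We now recall the existence of Galois representations associated with characteristic zero and characteristic $p$ cohomology classes following \cite{ArthurBook} and \cite{ScholzeTorsion}. These Galois representations all satisfy local-global compatibility for $\ell \not\in S$, as we make precise. In characteristic zero, we prove local-global compatibility at $\ell=p$ for $\tilde{G}(\A)$ in Theorem \ref{Thm:PiCARoftildeGLG}, and recall it for $\GL_n$ in Theorem \ref{Thm:Char0ExistenceOfGalRACAR}." — the characteristic-0 input is `BGWchar0`; the characteristic-p input is Theorem [Scholze] (Thm:GaloisRepForTorClass): l.3435 "\begin{theorem}[Scholze] \label{Thm:GaloisRepForTorClass}" [for 𝔫 a maximal ideal with finite residue field of the prime-to-S Hecke algebra of H^*(X_{G̃,K}, 𝒪/ϖ^m) (resp. of X_{GL_n,K}): a continuous semisimple ρ̄_𝔫 : G_ℚ → GL_{2n+1}(𝔽̄_p) (resp. GL_n(𝔽̄_p)) matching the Hecke polynomials at ℓ ∉ S] —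 proof: l.3448 "    For the standard representation for general symplectic groups, the existence is explained in the proof of \cite[Corollary 5.2.6]{ScholzeTorsion} (and relies on Arthur's endscopic classification for symplectic groups \cite{ArthurBook}). The existence for general linear groups again follows from \cite{ScholzeTorsion} (which, in fact, uses the existence for general symplectic groups as input)." — typed, as the authors name it, ⇐ the book (NOT through row C12's `Consumers.ScholzeTR`, which records Scholze's totally-real-or-CM sentence ⇐ book ∧ Mok: Theorem D lives over ℚ); the strategy l.452 "The proof of Theorem \ref{FourthMainThmintroLGcompat} occupies all of \S\ref{LGcompatAtl=pSec}, and follows the strategy of \cite[\S5]{10author}. More precisely, $\rho$ is constructed by realising the Hecke eigensystem for $\mathcal{T}_{\ide{m}}$ in the boundary cohomology of the Shimura variety associated with $\opn{GSp}_{2n}$, and using known local-global compatibility results at $\ell = p$ for standard Galois representations associated with automorphic representations of $\opn{GSp}_{2n}$ (i.e., known local-global compatibility results for essentially self-dual cuspidal automorphic representations of $\opn{GL}_{2n+1}$ in, e.g., \cite{BGGTII}). One of the key ingredients is the recent vanishing results for the mod $p$ cohomology of abelian-type Shimura varieties in \cite{YangZhu}." The Remark after Theorem D: l.449 "Furthermore,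 the existence of such a Galois representation satisfying (1) essentially follows from \cite[Theorem 1.1.6]{CGHJMRS} (see also \cite{ScholzeTorsion, NewtonThorneTorsion}) -- our main contribution is parts (2) and (3)." — [10author] (Allen – Calegari – Caraiani – Gee – Helm – Le Hung – Newton – Scholze – Taylor – Thorne: census control, no invocation), [YangZhu], [CGHJMRS], [NewtonThorneTorsion], [ChenevierPadic]: absorbed, their own classification inputs (if any) not traced in this edge.  The authors' status sentence: l.460 "    The proof of Theorem \ref{FourthMainThmintroLGcompat} relies on the endoscopic classification for symplectic groups in \cite{ArthurBook}. Although \emph{op.cit.} is still conditional on forthcoming work, there has been a tremendous amount of progress towards making this unconditional in \cite{LocalIntertwiningRelations}. At present, the only thing that remains is the proof of the twisted weighted fundamental lemma." ([LocalIntertwiningRelations] = AGIKMS arXiv:2410.13504, the register's preprint layer).  Premises: `BGWchar0`, the book. [cite: BarreraGrahamWilliams2025LGCEZC, Thm D with §1 (l.451, l.459-461), §9 (l.3286, l.3435-3449); Scholze2015, Cor. 5.2.6 (as cited); Arthur2013 (as cited)] -/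
def E_BGWthmD : Prop := c₈₂.BGWchar0 → (∀ N, ν.Everything N) → c₈₂.BGWthmD

/-- C206's THEOREM B, PREMISE-FREE: l.340 "\begin{theoremx} \label{SecondMainThmIntroAutLinv}" l.341 "    Let $n=3$ and $c \in \{0, 1\}$. Then " [d/ds L_p^{(c)}(π, s)|_{s=0} = e_∞(π_∞, c) · E_p^{(c)}(c) · 𝓛^{Aut}_{π,c+1} · L(π, c)/Ω_{π,c}] l.274 "Theorem \ref{SecondMainThmIntroAutLinv} is completely unconditional (beyond Assumption \ref{assumptions}(1), which is needed for the statement to make sense), and is even independent of the existence of $\rho_\pi$. Assumption \ref{assumptions}(2), and the other hypotheses in Theorem \ref{FirstMainThmInIntro}, are needed only to prove the equality of $\mathcal{L}$-invariants (Theorem \ref{ThirdMainThmIntroEqualLinv})."  No premise. [cite: BarreraGrahamWilliams2025LGCEZC, Thm B with l.274] -/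
def E_BGWthmB : Prop := c₈₂.BGWthmB

/-- C206's THEOREMS A AND C ⇐ THEOREM D: l.420 "If we can find such a Galois representation, comparing both Benois--Colmez--Greenberg--Stevens formulae yields Theorem \ref{ThirdMainThmIntroEqualLinv}. The second bullet point is the titular local-global compatibility at $\ell = p$ for Hida families. The existence of the Galois representation $\rho_{\underline{\pi}}$ with the required properties follows from Theorem \ref{FourthMainThmintroLGcompat} below, and in fact, we establish this local-global compatibility for $\opn{GL}_n$ for general $n \geq 2$." l.399 "Combining Theorems \ref{SecondMainThmIntroAutLinv} and \ref{ThirdMainThmIntroEqualLinv} yields Theorem \ref{FirstMainThmInIntro}, noting that $\pi$ always has either non-$s_1$-infinitesimal or non-$s_2$-infinitesimal deformations." — Theorem B (`BGWthmB`, premise-free) is the other half of A; the comparison of Benois – Colmez – Greenberg – Stevens formulae, Gehrmann – Rosso's strategy, the GL(3)-eigenvariety: Arthur-free, absorbed.  Premise: `BGWthmD`. [cite: BarreraGrahamWilliams2025LGCEZC, §1.2 (l.399, l.420)] -/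
def E_BGWezc : Prop := c₈₂.BGWthmD → c₈₂.BGWezc

/-- C207's THEOREMS 2.3 / 2.6 ⇐ ROW E1 (`src-2411.04897v2/…tex`): Theorem 2.3 is « By [Shin2024, Corollary 2.5.3] » = Shin's weak transfer in Case S (`Shin.WeakS`, Essent. Number Theory 3 (2024), Thm 1.1.2; typed in `Downstream.lean` ⇐ StabTw ∧ StabOrd ∧ StabInner ∧ SpecGLN, i.e. under his (H1)); Theorem 2.6 (1) is « proved in [Shin2024, Theorem 3.2.7] » = his Thm 1.2.2, whose Case-S content beyond the weak transfer is Step 1 — the published GL_N Galois representations, `Shin.GalRepGLN` — under (H2), (H3) = the author's (C2), a hypothesis on π inside the statement; [ChenevierHarris2013], [Barnet-LambGeeGeraghtyTaylor2014], [Taylor2012, Taibi2016, CaraianiLeHung2016]: Arthur-free, absorbed.  THE AUTHOR'S STATUS SENTENCE (the whole proof of Theorem 2.3): l.995 "The proof of \cite[Corollary 2.5.3]{Shin2024} relies on the assumptions that the weighted fundamental lemma is true for non-split groups and its non-standard version is also true (this is the assumption (H1) in \emph{loc.cit}), which is used to ensure the stabilized trace formula. However, this is already proved in \cite{Arthur2001,Arthur2002,Arthur2003}."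 — (H1) is the register's pair of UNWRITTEN leaves `WFL_general` ∧ `WFL_nonstandard`; [Arthur2001–2003] = the stable trace formula I–III, conditional on the weighted fundamental lemma (Chaudouard – Laumon 2010/2012: split groups); Shin's own text (row E1): « the WFL for Lie algebras remains to be verified for nonsplit groups. The nonstandard WFL is open at this time. »  v1 of the paper read, at this place: p0007:L66 "Shin2024. assumes (C1), which is used to establish Arthur's trace formula. However, by our assumptions (C1), (C2) and (C3), the main result of [Taibi2018] proved this trace formula for the full automorphic spectrum of $G(\mathbb{A}_F)$. Thus [Shin2024] again holds." ([Taibi2018] = row A3).  Premises: `Shin.WeakS`, `Shin.GalRepGLN`. [cite: XZhang2024TaylorWilesOrthogonal, Thm 2.3 with proof (l.985-997), Thm 2.6 with proof (l.1082-1118); Shin2024, Thm 1.1.2, Thm 1.2.2, (H1) (p0006:L5-13)] -/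
def E_XZgalois : Prop := s.WeakS → s.GalRepGLN → c₈₂.XZgalois

/-- C207's THEOREM 1.1 (R ≃ 𝕋; = Theorems 6.4 / 6.5) ⇐ ITS GALOIS REPRESENTATIONS: the deformation side (§5) and the patching (§6) start from r_π and ρ̄_𝔪 of Theorem 2.6; between §3 (l.1141) and §7 (l.10651) the source cites none of [Arthur2013], [Shin2024], [Taibi2018]; Hecke algebras, Bernstein centre, types, Taylor – Wiles primes: Arthur-free, absorbed.  Premise: `XZgalois`. [cite: XZhang2024TaylorWilesOrthogonal, Thm 1.1 (l.371), §6 Thms 6.4 / 6.5 (l.10366, l.10596)] -/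
def E_XZRT : Prop := c₈₂.XZgalois → c₈₂.XZRT

/-- C207's BLOCH – KATO THEOREMS 7.5 / 7.6 ⇐ R ≃ 𝕋 ∧ ROW A3 ∧ THE BOOK (`src-2411.04897v2/…tex` §7): l.10948 "By \cite[Theorem 4.0.1]{Taibi2018}, we know that the space of automorphic forms $\mathcal{A}(G(\mathbb{A}_F))$ satisfies the \emph{multiplicity-one} theorem and thus the localization" [𝕄 := M_{W,p}(K, 𝒪)_𝔪 is free of rank one over the Hecke algebra 𝕋] — « [Taibi2018, Theorem 4.0.1] » = row A3's `Consumers.TaibiInner` (Arthur's multiplicity formula for the inner forms compact at infinity, tranche 1 ⇐ book ∧ StabInner ∧ AMR); and [By [Arthur2013, Theorem 1.5.3(a)] L(ρ_π, s) is holomorphic and non-zero at s = 1 — verbatim in the `--` comment above] ↦ the book; the Rallis inner product formula, [TilouineUrban2022], the theta correspondence: Arthur-free, absorbed.  Premises: `XZRT`, `TaibiInner` (A3), the book. [cite: XZhang2024TaylorWilesOrthogonal, §7 (l.10948, l.11011), Thms 7.5 / 7.6; Taibi2018, Thm 4.0.1; Arthur2013, Thm 1.5.3 (a) (as cited)] 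-/
def E_XZBK : Prop := c₈₂.XZRT → c.TaibiInner → (∀ N, ν.Everything N) → c₈₂.XZBK

/-- C208's THEOREM ⇐ MOK ∧ ROW C141 (`src-2110.10251v1/HigherColemanarxiv.tex`): §1.4 l.360 "The theorem is proved by first descending $\pi$ to a cuspidal automorphic representation on a quasi-split unitary group over $L$, which then contributes to the interior coherent cohomology of the corresponding Shimura variety.  Then we apply point (4) of theorem \ref{thm-eigenvariety-intro} to get a point on the eigenvariety which is a limit of regular weight classical points, and conclude using results of Kisin \cite{MR1992017} on the interpolation of crystalline periods in analytic families, as in the work of Jorza and Mok \cite{MR3039824}, \cite{MR3200667}." — l.5412 "\subsection{Application: construction of Galois representations and local-global compatibility $p$}\label{subsec-localglobal} " […] l.5431 "The techniques of this paper allows for a new construction of the Galois representation via analytic families. The advantage of this construction is that we can prove some instances of local-global compatibility at $p$, using results of Kisin \cite{MR1992017} on the interpolation of crystalline periods in analytic families, as in the work of Jorza and Mok \cite{MR3039824}, \cite{MR3200667}." [the Theorem restated, l.5433-5447] — proof: l.5449 "The existence of a Galois representation satisfying points (1) and (2) is already known (see \cite{F-Pilloni}, theorem 9.10).  In order to prove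 points (3) and (4), by base change we may assume that $L$ is CM with maximal totally real subfield $F$, all the primes above $p$ in $F$ split in $L$, and for all primes $v\mid p$ of $L$, $\pi_v$ is a constituent of a principal series representation (and so has finite slope in the sense of section \ref{subsection-jacquet})." l.5451 "Let $\mathrm{GU}(n)/F$ be the quasi-split unitary similitude group in $n$ variables, and let $G\subset\mathrm{Res}_{F/\qq}$ be the subgroup where the similitude factor lands in $\mathbb{G}_m\subseteq\mathrm{Res}_{F/\qq}\mathbb{G}_m$.  The group $G$ admits a PEL Shimura datum $(G,X)$, so that $\pi$ realizes in the interior coherent cohomology of the corresponding Shimura variety, as explained in the proof of theorem 9.11 of \cite{F-Pilloni} (we note that this is conditional on the main results of \cite{MR3338302})." l.5453 "The result now follows from theorems \ref{thm-eigenvariety2} and \ref{thm-regular-galois}, using the results of \cite{MR1992017} as explained in proof of theorem 4.1 of \cite{MR3039824}." — [MR3338302] = Mok's memoir (bibliography entry in the `--` comment above) ↦ `∀ N, μ.Everything N` (the descent GL_n → quasi-split U(n): his main global theorems); [F-Pilloni], Thms 9.10 / 9.11 = row C141 Fakhruddin – Pilloni, J. Inst. Math. Jussieu 22 (2023) ↦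 `Consumers74.FPWeaklyRegular` (tranche 74, ⇐ Mok); Kisin [MR1992017], Jorza, Mok (Compos. 2014), [MR3512528], the paper's eigenvariety: Arthur-free, absorbed.  The authors' flag (§1.4 Remark): « therefore conditional on the results announced in [MR3135650] ».  Premises: Mok, `FPWeaklyRegular` (C141). [cite: BoxerPilloni2021HigherColeman, §1.4 (l.360-362), §6.11 proof (l.5449-5453); FakhruddinPilloni2023Hecke, Thms 9.10, 9.11 (as cited); Mok2012 (as cited)] -/
def E_BPweakRegLGC : Prop := (∀ N, μ.Everything N) → c₇₄.FPWeaklyRegular → c₈₂.BPweakRegLGC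

/-- C209's COROLLARY 4.1.1 / LEMMA 4.1.7 ⇐ THE BOOK ∧ ROW A4 ∧ ROW A3, the three references of the authors' own sentence (`paper-doi-10-4171-dm-960` §1): p0005:L39-41 "by choosing the same Taylor–Wiles datum and ultrafilter. In order to attach Galois representations to a regular algebraic cuspidal automorphic representation of G , we need to apply Jacquet–Langlands for GSp4 proven in [52] under stable and tempered assumptions. In Lemma 4.1.7, we show that automorphic representations of G of our concern are indeed stable and tempered by using various results on Arthur multiplicity formula" [[2, 28, 54].] — « [2] » = the book ↦ `∀ N, ν.Everything N`; « [28] » = row A4 Gee – Taïbi, J. Éc. polytech. Math. 6 (2019) ↦ `Consumers.GeeTaibi` (tranche 1 ⇐ book ∧ StabOrdSim ∧ StabTwSim ∧ [MW I 4.11]); « [54] » = row A3 Taïbi 2019 ↦ `Consumers.TaibiInner`; « [6, Theorem 2.9.3] » (row C9's summary of the GSp_4 classification, from [28]) and « [1] » (Arthur 2004, the announcement): absorbed into the A4 premise; « [52] » Sorensen 2009 and Piatetski-Shapiro – Soudry on CAP forms: Arthur-free, absorbed.  The authors' flag: p0037:L7 "This classification was proven in [28], conditional on unpublished results of" p0037:L8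 "Arthur, Moeglin and Waldspurger. We freely use consequences of the classification below."  Premises: the book, `GeeTaibi` (A4), `TaibiInner` (A3). [cite: EnnsLee2024ModpLGCGSp4, §1 (p0005:L39-42), §4.1 (p0037:L5-13), Lemma 4.1.7 (p0039:L30-36); GeeTaibi2019, Thm 7.4.1; Taibi2018, Thm 4.0.1; Arthur2013 (as cited)] -/
def E_ELstableTempered : Prop := (∀ N, ν.Everything N) → c.GeeTaibi → c.TaibiInner → c₈₂.ELstableTempered

/-- C209's THEOREM 4.5.1 ⇐ ITS STABILITY LEMMA: §4.1 p0037:L5-6 "A multiplicity-preserving Jacquet-Langlands transfer from automorphic representations of G to GSp4 was proven by Sorensen in [52, Theorem B] for stable and tempered representations. (See [52, Section 1] for the definition of stable and tempered.)" [§4: Moreover, such π] p0041:L47 "is necessarily stable and tempered by Lemma 4.1.7, and we can apply" [the Jacquet – Langlands transfer [52]; §4.5:] p0048:L15 "By Lemmas 4.4.4, 4.1.7, and [52, Theorem B], there exists an" […] — the Galois representations attached to the relevant automorphic representations of the inner form come through the Jacquet – Langlands transfer [52], applicable because the representations are stable and tempered (`ELstableTempered`); patching, Kisin modules, Fontaine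 – Laffaille theory, [BCGP]'s p-adic arguments « with ideas from [6] »: absorbed (row C9's own dependence is typed in tranche 1 and not re-routed here).  Premise: `ELstableTempered`. [cite: EnnsLee2024ModpLGCGSp4, §4.2–4.5 (p0041:L47, p0048:L15), Thm 4.5.1] -/
def E_ELmain : Prop := c₈₂.ELstableTempered → c₈₂.ELmain

/-- The eighty-second tranche of implications (two premise-bearing book edges for C206 + one premise-free + one row edge; C207 through row E1's `Shin`, row A3 and the book; C208 through Mok and row C141; C209 through the book, A4, A3). [cite: BarreraGrahamWilliams2025LGCEZC, §9; XZhang2024TaylorWilesOrthogonal, §2; BoxerPilloni2021HigherColeman, §6.11; EnnsLee2024ModpLGCGSp4, §4.1 (each edge's source in its own docstring)] -/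
structure Implications82 : Prop where
  bgwChar0 : E_BGWchar0 ν c₈₂
  bgwThmD : E_BGWthmD ν c₈₂
  bgwThmB : E_BGWthmB c₈₂
  bgwEzc : E_BGWezc c₈₂
  xzGalois : E_XZgalois s c₈₂
  xzRT : E_XZRT c₈₂
  xzBK : E_XZBK ν c c₈₂
  bp : E_BPweakRegLGC μ c₇₄ c₈₂
  el : E_ELstableTempered ν c c₈₂
  elMain : E_ELmain c₈₂

variable {ν μ κ c s c₇₄ c₈₂}

/-- C206's THEOREM B OUTRIGHT (no DAG input at all). [cite: BarreraGrahamWilliams2025LGCEZC, Thm B (bookkeeping proved here)] -/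
theorem bgwThmB_unconditional (X : Implications82 ν μ c s c₇₄ c₈₂) : c₈₂.BGWthmB :=
  X.bgwThmB

/-- ALL OF C206 GIVEN THE BOOK AT ALL RANKS. [cite: BarreraGrahamWilliams2025LGCEZC, Thms A–D (bookkeeping proved here)] -/
theorem bgw_of_book (X : Implications82 ν μ c s c₇₄ c₈₂) (hν : ∀ N, ν.Everything N) :
    c₈₂.BGWchar0 ∧ c₈₂.BGWthmD ∧ c₈₂.BGWthmB ∧ c₈₂.BGWezc :=
  have h0 := X.bgwChar0 hν
  have hD := X.bgwThmD h0 hν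
  ⟨h0, hD, X.bgwThmB, X.bgwEzc hD⟩

/-- C206's THEOREMS A / C FROM THE BOOK'S INPUTS — every one of the book's 24 leaves, nothing of Mok or KMSW. [cite: BarreraGrahamWilliams2025LGCEZC, Thms A, C (bookkeeping proved here)] -/
theorem bgwEzc_of_inputs (X : Implications82 ν μ c s c₇₄ c₈₂) (A : BookInputs ν) : c₈₂.BGWezc :=
  (bgw_of_book X A.everything).2.2.2

/-- C206's THEOREM D IN CONDITIONAL FORM, 2026: granting the book's internal derivations, its supply edges and every PUBLISHED input, local-global
compatibility at ℓ = p for the ordinary torsion eigensystems of GL_n/ℚ is conditional on the 2024–2026 preprint layer and on the general and the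
non-standard weighted fundamental lemmas — the authors' Remark names [LocalIntertwiningRelations] and « the twisted weighted fundamental lemma »: the same
list up to the register's resolution of the twisted weighted FL into its two unwritten reductions. [cite: BarreraGrahamWilliams2025LGCEZC, Thm D, Remark l.459-461 (bookkeeping proved here)] -/
theorem bgwThmD_conditional_form (X : Implications82 ν μ c s c₇₄ c₈₂) (B : ν.BookEdges) (S : ν.SupplyEdges) (P : ν.PublishedLeaves) :
    ν.PreprintLeaves2026 → ν.WFL_general → ν.WFL_nonstandard → c₈₂.BGWthmD :=
  fun hQ h6 h7 => (bgw_of_book X (BookInputs.everything ⟨B, S, P, hQ, ⟨h6, h7⟩⟩)).2.1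

/-- ALL OF C207 GIVEN SHIN'S WEAK TRANSFER, THE GL_N GALOIS REPRESENTATIONS, ROW A3 AND THE BOOK. [cite: XZhang2024TaylorWilesOrthogonal, Thms 1.1, 1.5, 2.3, 2.6 (bookkeeping proved here)] -/
theorem xz_of_rows (X : Implications82 ν μ c s c₇₄ c₈₂) (hW : s.WeakS) (hG : s.GalRepGLN) (hT : c.TaibiInner) (hν : ∀ N, ν.Everything N) :
    c₈₂.XZgalois ∧ c₈₂.XZRT ∧ c₈₂.XZBK :=
  have hg := X.xzGalois hW hG
  have hr := X.xzRT hg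
  ⟨hg, hr, X.xzBK hr hT hν⟩

/-- C207's R ≃ 𝕋 FROM THE LEAVES OF SHIN'S WEAK TRANSFER (row E1's `Shin.weakS_of_leaves`: the supply edges, the published leaves, the two unwritten weighted
fundamental lemmas — no `BookEdges`, no `PreprintLeaves2026`) and the published GL_N Galois representations. [cite: XZhang2024TaylorWilesOrthogonal, Thm 1.1; Shin2024, Thm 1.1.2 (bookkeeping proved here)] -/
theorem xzRT_of_leaves (X : Implications82 ν μ c s c₇₄ c₈₂) (J : Shin.Implications ν μ κ c s) (I : Implications ν μ κ c)
    (S : ν.SupplyEdges) (P : ν.PublishedLeaves) (U : ν.UnwrittenLeaves) (gal : s.GalRepGLN) : c₈₂.XZRT :=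
  X.xzRT (X.xzGalois (Shin.weakS_of_leaves J I S P U) gal)

/-- C207's R ≃ 𝕋 IN CONDITIONAL FORM, 2026: granting the supply edges, every PUBLISHED input, the register's first tranche and Shin's derivations, it is
conditional EXACTLY on the general and the non-standard weighted fundamental lemmas — Shin's (H1), which the author's proof of Theorem 2.3 declares « already
proved in [Arthur2001, Arthur2002, Arthur2003] ». [cite: XZhang2024TaylorWilesOrthogonal, Thm 1.1, proof of Thm 2.3 (l.995-997); Shin2024, (H1) (bookkeeping proved here)] -/
theorem xzRT_conditional_form (X : Implications82 ν μ c s c₇₄ c₈₂) (J : Shin.Implications ν μ κ c s) (I : Implications ν μ κ c)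
    (S : ν.SupplyEdges) (P : ν.PublishedLeaves) (gal : s.GalRepGLN) : ν.WFL_general → ν.WFL_nonstandard → c₈₂.XZRT :=
  fun h6 h7 => xzRT_of_leaves X J I S P ⟨h6, h7⟩ gal

/-- C207's BLOCH – KATO THEOREMS FROM THE BOOK'S INPUTS (all 24 leaves: through Theorem 1.5.3 and through row A3), Shin's derivations and the GL_N Galois
representations. [cite: XZhang2024TaylorWilesOrthogonal, Thms 7.5, 7.6; Taibi2018, Thm 4.0.1 (bookkeeping proved here)] -/
theorem xzBK_of_inputs (X : Implications82 ν μ c s c₇₄ c₈₂) (J : Shin.Implications ν μ κ c s) (I : Implications ν μ κ c) (A : BookInputs ν)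
    (gal : s.GalRepGLN) : c₈₂.XZBK :=
  X.xzBK (xzRT_of_leaves X J I A.supplies A.published A.unwritten gal) (taibiInner_of_leaves I A) A.everything

/-- C208's THEOREM GIVEN MOK AT ALL RANKS AND ROW C141. [cite: BoxerPilloni2021HigherColeman, §6.11 Theorem (bookkeeping proved here)] -/
theorem bp_of_mok_and_row (X : Implications82 ν μ c s c₇₄ c₈₂) (hμ : ∀ N, μ.Everything N) (hFP : c₇₄.FPWeaklyRegular) : c₈₂.BPweakRegLGC :=
  X.bp hμ hFP

/-- C208's THEOREM FROM MOK'S INPUTS — row C141 by tranche 74's edge (⇐ Mok again): every one of Mok's 29 leaves, nothing of the book or KMSW as typed. [cite: BoxerPilloni2021HigherColeman, §6.11 Theorem; FakhruddinPilloni2023Hecke, Thm 9.11 (bookkeeping proved here)] -/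
theorem bp_of_mokInputs (X : Implications82 ν μ c s c₇₄ c₈₂) (Z : Implications74 μ κ c c₇₄) (M : MokInputs μ) : c₈₂.BPweakRegLGC :=
  bp_of_mok_and_row X M.everything (Z.fakhruddinPilloni M.everything)

/-- C208's THEOREM IN CONDITIONAL FORM, 2026: granting Mok's section edges, supply edges and every PUBLISHED input (and tranche 74's edge), it is conditional
on Mok's 2024–2026 preprint layer and on Mok's general and non-standard weighted fundamental lemmas; the authors' flag names « the results announced in
[MR3135650] ». [cite: BoxerPilloni2021HigherColeman, §1.4 Remark (l.362) (bookkeeping proved here)] -/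
theorem bp_conditional_form (X : Implications82 ν μ c s c₇₄ c₈₂) (Z : Implications74 μ κ c c₇₄) (MB : μ.SectionEdges) (MS : μ.SupplyEdges)
    (MP : μ.PublishedLeaves) : μ.PreprintLeaves2026 → μ.WFL_general → μ.WFL_nonstandard → c₈₂.BPweakRegLGC :=
  fun hQ h6 h7 => bp_of_mokInputs X Z ⟨MB, MS, MP, hQ, ⟨h6, h7⟩⟩

/-- ALL OF C209 GIVEN THE BOOK AT ALL RANKS AND ROWS A4, A3. [cite: EnnsLee2024ModpLGCGSp4, Cor. 4.1.1, Lemma 4.1.7, Thm 4.5.1 (bookkeeping proved here)] -/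
theorem el_of_rows (X : Implications82 ν μ c s c₇₄ c₈₂) (hν : ∀ N, ν.Everything N) (hGT : c.GeeTaibi) (hT : c.TaibiInner) :
    c₈₂.ELstableTempered ∧ c₈₂.ELmain :=
  have h := X.el hν hGT hT
  ⟨h, X.elMain h⟩

/-- C209's THEOREM 4.5.1 FROM THE BOOK'S INPUTS — rows A4 and A3 by tranche 1's `geeTaibi_of_leaves` / `taibiInner_of_leaves`: every one of the book's 24
leaves, nothing of Mok or KMSW. [cite: EnnsLee2024ModpLGCGSp4, Thm 4.5.1; GeeTaibi2019, Thm 7.4.1; Taibi2018, Thm 4.0.1 (bookkeeping proved here)] -/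
theorem elMain_of_inputs (X : Implications82 ν μ c s c₇₄ c₈₂) (I : Implications ν μ κ c) (A : BookInputs ν) : c₈₂.ELmain :=
  (el_of_rows X A.everything (geeTaibi_of_leaves I A) (taibiInner_of_leaves I A)).2

/-- C209's THEOREM 4.5.1 IN CONDITIONAL FORM, 2026 (a PUBLISHED 2024 theorem): granting the book's internal derivations, its supply edges, every PUBLISHED
input and the first tranche's edges, it is conditional on the 2024–2026 preprint layer and on the general and the non-standard weighted fundamental lemmas;
the authors' flag names « unpublished results of Arthur, Moeglin and Waldspurger ». [cite: EnnsLee2024ModpLGCGSp4, Thm 4.5.1, §4.1 (p0037:L7-8) (bookkeeping proved here)] -/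
theorem elMain_conditional_form (X : Implications82 ν μ c s c₇₄ c₈₂) (I : Implications ν μ κ c) (B : ν.BookEdges) (S : ν.SupplyEdges)
    (P : ν.PublishedLeaves) : ν.PreprintLeaves2026 → ν.WFL_general → ν.WFL_nonstandard → c₈₂.ELmain :=
  fun hQ h6 h7 => elMain_of_inputs X I ⟨B, S, P, hQ, ⟨h6, h7⟩⟩

end Downstream

end Literature.NumberTheory.Automorphic.Arthur2013
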